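import Literature.NumberTheory.LFunctions.WeilSemilocalCompactnessProofs
import Literature.NumberTheory.LFunctions.WeilExplicitArchTermProofs
import Literature.NumberTheory.LFunctions.WeilFinitePrimeQuadratic
import Literature.NumberTheory.LFunctions.RiemannSiegelFacts
import Literature.Analysis.SpecialFunctions.DigammaStirlingSeries
import Literature.NumberTheory.ConnesConsani2021.VanishingConditions
import Literature.Analysis.Fourier.TrigAutocorrelationDividedDifference
import HarnessLib

/-!
# Connes–Consani–Moscovici, *Zeta spectral triples*, §2–§3: the algebra `L¹(ℝ)`, the basis `U_n`,
# the Weil quadratic form `QW` and its window restriction `QW_λ` — STATEMENT LAYER (+ the elementary proofs)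

LINE 1 — LABEL: **RH-FREE corpus literature.** Everything in this file is harmonic analysis of compactly
supported functions and the bookkeeping of Weil's explicit-formula functional on a window; no statement
here is a positivity statement, none has an RH direction, nothing here bears on the truth of RH.
Cell `rh-crit`, sub-cell `cc/`, typer seat t15 (ASSIGNMENTS row t15); bears_on W-C/W-P as SEQUEL TYPING
(no leaf role).  WHAT THIS IS NOT: a claim about RH, a new conjecture, a route.

Source: A. Connes, C. Consani, H. Moscovici, *Zeta spectral triples*, arXiv:2511.22755v1 (27 Nov 2025)
[bib `ConnesConsaniMoscovici2025`]; published version: EMS Ser. Lect. Math. **37** (2026) 39–76,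
doi:10.4171/elm/37/3 [bib `ConnesConsaniMoscovici2026`].  Locators `§ / numbered item / p. N` are the
PRINTED page numbers of arXiv v1 (PDF pages: printed p. 4 = PDF pp. 4–6, printed p. N = PDF p. N+2 for
N ≥ 5), read from the materialised text `paper:arxiv-2511.22755` pp. 1–13.

## Dictionary (the tree's additive normalisation; NO parallel vocabulary is opened)

The paper works on `ℝ₊*` with `d*u = du/u` and on `L¹(ℝ, dx)`; the tree works additively (`u = e^t`,
`Literature/NumberTheory/LFunctions/WeilExplicit.lean`).  Symbol by symbol:
* Def. 2.1 (2.1) `(f ∗ g)(y) = ∫ f(x) g(y − x) dx` IS `weilConv f g` (`weilConv_apply`); (2.2)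
  `f*(y) = conj f(−y)` IS `weilReflect f`.  No new definition (`def_2_1_product`, `def_2_1_involution`).
* (3.1)/(3.5) `f̃(s)`, `F̂(s) = ∫ F(u) u^{-is} d*u` ↦ `ConnesConsani2021.mulFourier g s = weilMellin g (1/2 − is)`
  (`mulFourier_eq_weilMellin`); `F̂(i/2) = weilMellin g 1`, `F̂(−i/2) = weilMellin g 0`.
* (3.11) `W_{0,2}(F) = F̂(i/2) + F̂(−i/2)` ↦ `weilPolarTerm g`; (3.3)/(3.7) `Σ_p W_p(F)` ↦ `weilPrimeTerm g`
  (von Mangoldt form); (3.4) `W_ℝ(F)` (Bombieri's form) ↦ `−weilArchTermBombieri g = −ConnesConsani2021.archW g`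
  (`= ConnesConsani2021.bombieriWR`, `ccWInfty_mulLift`); (3.8)–(3.9) `W_∞(F) = ∫ F̂(t) 2∂_tθ(t)/(2π) dt`,
  `θ` the Riemann–Siegel angular function ↦ `weilArchTerm g` with `2∂_tθ(t) = 2 · riemannSiegelThetaDeriv t
  = Re ψ(1/4 + it/2) − log π`; the identity `W_ℝ = −W_∞` asserted on p. 6 is the tree's PROVED
  `weilArchTermBombieri_eq_weilArchTerm_holds`.
* (3.10) `Ψ = W_{0,2} − W_ℝ − Σ_p W_p` ↦ `psiFunctional k := weilPolarTerm k − weilPrimeTerm k + archW k`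
  (`= weilFunctional k` on test functions, `psiFunctional_eq_weilFunctional`); `QW(f, g) = Ψ(f* ∗ g)` ↦
  `weilSesqForm f g`; on the diagonal `QW(f, f) = weilQuadratic f` (`weilSesqForm_self`).
* `λ > 1`, `L = 2 log λ`, window `[λ⁻¹, λ]` ↦ additive window `[−L/2, L/2] = [−a, a]`, `a = log λ`;
  `L²([λ⁻¹, λ], d*u) = L²([−a, a], dt)`; `QW_λ` ↦ `weilQuadratic` on test functions with
  `tsupport ⊆ Icc (−a) a` (the standing identification of `WeilSemilocalCompactness.lean`).
* Prop. 3.3 "lower bounded" ↦ PROVED `bddBelow_weilQuadratic_sphere_holds`; `μ_λ` (Cor. 3.7) ↦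
  `weilGroundEnergy a`; ground state ↦ `IsWeilGroundState a u`; Prop. 3.5 (1)⇔(4) + Thm. 3.6 ↦
  `ConnesConsaniMoscovici2025_thm_3_6` (PROVED, `…_holds`, `WeilSemilocalCompactnessProofs.lean`).

## What is typed here, item by item (§2: pp. 2–4; §3: pp. 5–10)

| printed item | decl | status |
|---|---|---|
| Def. 2.1, (2.1)–(2.2), p. 3 | `def_2_1_product`, `def_2_1_involution` | dictionary (rfl-level) |
| (2.3) `⟨f,g⟩₂ = (f* ∗ g)(0)`, p. 3 | `inner_eq_weilConv_weilReflect_zero` | PROVED |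
| (2.4) `q(f,g)(y) = (f* ∗ g)(y) + (f* ∗ g)(−y)`, p. 3 | `qForm` | def |
| (2.5), p. 3 | `weilConv_weilReflect_neg`, `qForm_eq` | PROVED **with an erratum** (below) |
| Lemma 2.2, p. 3 | `ConnesConsaniMoscovici2025_lemma_2_2`, `…_lemma_2_2_qForm` | PROVED |
| (2.6) `U_n`, p. 3 | `uCore`, `uBasis`; orthonormality `integral_conj_uBasis_mul_uBasis` | def + PROVED |
| (2.7)–(2.10), Lemma 2.3, p. 4 | `ConnesConsaniMoscovici2025_eq_2_7`, `…_eq_2_10_conv`, `qBasisClosedForm`, `ConnesConsaniMoscovici2025_lemma_2_3` | PROVED |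
| (3.12)–(3.16) `Ψ♯ = W♯_{0,2} − W♯_ℝ − Σ W♯_p`, pp. 6–7 | `psiSharpPolar`, `psiSharpArch`, `psiSharpPrime`, `psiSharp` | defs |
| Lemma 3.1, p. 6 | `ConnesConsaniMoscovici2025_lemma_3_1` | PROVED |
| (3.17) `κ`, Prop. 3.2 (i), p. 7 | `kappaShift`, `…_prop_3_2_i_normSq`, `…_prop_3_2_i_changeOfVariables` | def + PROVED |
| Prop. 3.2 (ii), p. 7 | `…_prop_3_2_ii`, `…_prop_3_2_ii_of_isWeilTest` | PROVED |
| (3.19)–(3.20) `QW_λ`, `T(n)`, p. 8 | `tForm`, `conj_tForm`, `ConnesConsaniMoscovici2025_eq_3_19` | def + PROVED |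
| Prop. 3.3, p. 8 (= [4] Prop. 2.1) | lower bound: EXISTS `bddBelow_weilQuadratic_sphere_holds` (cited in the docstring, not restated); lsc: `ConnesConsaniMoscovici2025_prop_3_3` | NAMED FACT (lsc on the test core) |
| (3.21) `V_n = κ(U_n)`, p. 8 | `vBasis`, `vBasis_apply` | def + PROVED |
| Prop. 3.4, p. 8 | — | = [4] Prop. 2.3 + Cor. 2.4 VERBATIM → `ConnesConsani2023/ZetaCyclesSemilocalForm.lean` (seat t9); NOT restated |
| (3.23) `A_λ`, p. 9 | — | NOT typed (no form↔operator representation theorem in Mathlib); operator-free stand-ins: `weilGroundEnergy`, `IsWeilGroundState`, `ConnesConsaniMoscovici2025_thm_3_6` |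
| (3.24) `∂_tθ(t) = ½(log|t| − log 2 − log π) − 1/(48t²) + O(t⁻⁴)`, p. 9 | `ConnesConsaniMoscovici2025_eq_3_24` (+ `…_explicit` with the constant) | PROVED (from the tree's Stirling series `norm_digamma_sub_stirlingSeries_le`) |
| Prop. 3.5, Thm. 3.6, p. 9 | — | EXIST: `ConnesConsaniMoscovici2025_thm_3_6` (+ `_holds`) — cited, not restated |
| Cor. 3.7, p. 11 | `ConnesConsaniMoscovici2025_cor_3_7` | PROVED (one line from Thm. 3.6) |
| (3.27) `λ > λ′ ⇒ μ_λ ≤ μ_{λ′}`, p. 11 | — | EXISTS: `Literature.NumberTheory.LFunctions.weilGroundEnergy_anti` (not re-proved) |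
| Cor. 3.8, p. 11 | — | RH-direction statement; tree: `UniformWeilPositivityRH.lean` (`riemannHypothesis_iff_forall_weilPositivityOn`); summit-side material, NOT typed in Literature |

## ERRATUM (kernel-checked: `weilConv_weilReflect_neg`, `qForm_eq`)

Printed (2.5), p. 3: "`(f* ∗ g)(−y) = (f* ∗ g)*(y) = (g* ∗ f)(y)`, hence `q(f,g) = f* ∗ g + g* ∗ f`".
The middle step drops the complex conjugation of the involution (2.2): `h(−y) = conj (h*(y))`, so the
correct identity is `(f* ∗ g)(−y) = conj ((g* ∗ f)(y))` and `q(f,g)(y) = (f* ∗ g)(y) + conj((g* ∗ f)(y))`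
(for real-valued `f, g` the printed line is correct).  The paper's own next use, (2.8), takes the `2 Re` of
(2.7) — i.e. it uses the CORRECT identity — so (2.7)–(2.10), Lemma 2.3 and everything downstream are
unaffected.  We type (2.4) as the DEFINITION of `q` and prove the corrected (2.5).

## Hypotheses: where the tree's language is narrower than the paper's

The paper's Weil class `W(ℝ₊*)` (piecewise `C¹` with decay, p. 5) is not a tree notion; Lemma 3.1 and
Prop. 3.2 (ii) are proved here for kernels `k = f* ∗ g` that are CONTINUOUS WITH COMPACT SUPPORT (this covers
`f, g ∈ L²` with compact support, in particular `C^∞([0, L])` extended by zero and the basis `U_n`), and the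
explicit formula (3.2) itself is the tree's `explicit_formula` on `IsWeilTest`.
-- TODO(general form): Lemma 3.1 on the full Weil class `W(ℝ₊*)` once that class is a tree notion.

## References
* A. Connes, C. Consani, H. Moscovici, *Zeta spectral triples*, arXiv:2511.22755 (2025) §2–§3;
  EMS Ser. Lect. Math. 37 (2026) 39–76. (keys `ConnesConsaniMoscovici2025`, `ConnesConsaniMoscovici2026`)
* A. Connes, C. Consani, *Spectral triples and ζ-cycles*, Enseign. Math. 69 (2023) 93–148, §2.1 Prop. 2.1,
  Lemma 2.2, Prop. 2.3, Cor. 2.4 (= [4] of the source). (key `ConnesConsani2023`)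
* E. Bombieri, Rend. Lincei (9) 11 (2000), Thm. 2 (the explicit formula in this normalisation). (key `Bombieri2000Weil`)
* K. Schmüdgen, *Unbounded self-adjoint operators on Hilbert space*, GTM 265 (2012), Prop. 10.1, 10.6, Thm. 10.7
  (= [12] of the source).
-/

noncomputable section

open Complex Filter Set MeasureTheory Asymptotics
open scoped Real Topology ComplexConjugate ArithmeticFunction.vonMangoldt

namespace Literature.NumberTheory.ConnesConsani2025

open Literature.NumberTheory.LFunctions Literature.NumberTheory.ConnesConsani2021
open _root_.MeasureTheory

/-! ## §2.1 The Banach algebra `L¹(ℝ, dx)` (Def. 2.1, (2.1)–(2.5), Lemma 2.2; p. 3) -/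

section Algebra

variable (f g : ℝ → ℂ)

/-- **Def. 2.1, eq. (2.1)** (p. 3): the product `(f ∗ g)(y) := ∫ f(x) g(y − x) dx` of `L¹(ℝ, dx)` IS the
tree's `weilConv` (Mathlib's additive convolution); dictionary entry, no new notion.
[cite: ConnesConsaniMoscovici2025, §2.1 Def. 2.1 eq. (2.1), p. 3] -/
theorem def_2_1_product (y : ℝ) : weilConv f g y = ∫ x : ℝ, f x * g (y - x) :=
  weilConv_apply f g y

/-- **Def. 2.1, eq. (2.2)** (p. 3): the involution `f*(y) := conj f(−y)` IS the tree's `weilReflect`.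
[cite: ConnesConsaniMoscovici2025, §2.1 Def. 2.1 eq. (2.2), p. 3] -/
theorem def_2_1_involution (y : ℝ) : weilReflect f y = conj (f (-y)) :=
  rfl

/-- **Eq. (2.3)** (p. 3): `⟨f, g⟩₂ = ∫ conj f(x) g(x) dx = (f* ∗ g)(0)` (inner products antilinear in the
first variable).  Holds for all `f, g` (both sides are the same Bochner integral after `x ↦ −x`).
[cite: ConnesConsaniMoscovici2025, §2.1 eq. (2.3), p. 3] -/
theorem inner_eq_weilConv_weilReflect_zero :
    ∫ x : ℝ, conj (f x) * g x = weilConv (weilReflect f) g 0 := by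
  rw [weilConv_apply]
  have h := integral_neg_eq_self (μ := (volume : Measure ℝ)) (fun x : ℝ => conj (f x) * g x)
  simp only [weilReflect, zero_sub]
  exact h.symm

/-- **Eq. (2.4)** (p. 3): `q(f, g)(y) := (f* ∗ g)(y) + (f* ∗ g)(−y)`, "an even function of `y` depending
antilinearly on `f` and linearly on `g`".  (In §3: `q(f,g) = h + h∘ι` for `h = f* ∗ g`, `ι(u) = u⁻¹`.)
[cite: ConnesConsaniMoscovici2025, §2.1 eq. (2.4), p. 3] -/
def qForm (y : ℝ) : ℂ :=
  weilConv (weilReflect f) g y + weilConv (weilReflect f) g (-y)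

/-- `q(f, g)` is even (p. 3). [cite: ConnesConsaniMoscovici2025, §2.1 eq. (2.4), p. 3] -/
theorem qForm_neg (y : ℝ) : qForm f g (-y) = qForm f g y := by
  simp only [qForm, neg_neg]
  exact add_comm _ _

/-- **Eq. (2.5), CORRECTED** (see the module ERRATUM): `(f* ∗ g)(−y) = conj ((g* ∗ f)(y))` for all
`f, g : ℝ → ℂ` and `y` (the printed line omits `conj`).  Proof: `conj ∫ conj g(−u) f(y−u) du
= ∫ g(−u) conj f(y−u) du`, then `u ↦ u + y`. [cite: ConnesConsaniMoscovici2025, §2.1 eq. (2.5), p. 3] -/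
theorem weilConv_weilReflect_neg (y : ℝ) :
    weilConv (weilReflect f) g (-y) = conj (weilConv (weilReflect g) f y) := by
  rw [weilConv_apply, weilConv_apply, ← integral_conj]
  simp only [weilReflect, map_mul, Complex.conj_conj]
  have h := integral_add_right_eq_self (μ := (volume : Measure ℝ))
    (fun u : ℝ => g (-u) * conj (f (y - u))) y
  rw [← h]
  congr 1
  funext u
  rw [show -(u + y) = -y - u by ring, show y - (u + y) = -u by ring, mul_comm]

/-- `q(f, g)(y) = (f* ∗ g)(y) + conj ((g* ∗ f)(y))` — (2.5) in its corrected form.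
[cite: ConnesConsaniMoscovici2025, §2.1 eq. (2.5), p. 3] -/
theorem qForm_eq (y : ℝ) :
    qForm f g y = weilConv (weilReflect f) g y + conj (weilConv (weilReflect g) f y) := by
  rw [qForm, weilConv_weilReflect_neg]

/-- On the diagonal `q(f, f)(y) = 2 Re (f* ∗ f)(y)` (the form in which (2.8)/(2.10) use (2.5)).
[cite: ConnesConsaniMoscovici2025, §2.2 eq. (2.8), p. 4] -/
theorem qForm_self (y : ℝ) :
    qForm f f y = ((2 * (weilConv (weilReflect f) f y).re : ℝ) : ℂ) := by
  rw [qForm_eq, Complex.add_conj]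

/-- **Lemma 2.2** (p. 3): for `f_a(x) := f(x − a)`, `(f_a)* ∗ g_a = f* ∗ g` (translation invariance of
`dx`).  Holds for all `f, g : ℝ → ℂ`, `a : ℝ`. [cite: ConnesConsaniMoscovici2025, §2.1 Lemma 2.2, p. 3] -/
theorem ConnesConsaniMoscovici2025_lemma_2_2 (a : ℝ) :
    weilConv (weilReflect fun x => f (x - a)) (fun x => g (x - a)) = weilConv (weilReflect f) g := by
  funext y
  rw [weilConv_apply, weilConv_apply]
  simp only [weilReflect]
  have h := integral_add_right_eq_self (μ := (volume : Measure ℝ))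
    (fun u : ℝ => conj (f (-u)) * g (y - u)) a
  rw [← h]
  congr 1
  funext u
  rw [show -(u + a) = -u - a by ring, show y - (u + a) = y - u - a by ring]

/-- **Lemma 2.2, second clause** (p. 3): `q(f_a, g_a) = q(f, g)`.
[cite: ConnesConsaniMoscovici2025, §2.1 Lemma 2.2, p. 3] -/
theorem ConnesConsaniMoscovici2025_lemma_2_2_qForm (a : ℝ) :
    qForm (fun x => f (x - a)) (fun x => g (x - a)) = qForm f g := by
  funext y
  simp only [qForm, ConnesConsaniMoscovici2025_lemma_2_2]

end Algebra

/-! ## §2.2 The basis `{U_n}_{n ∈ ℤ}` of `L²([0, L])` ((2.6)–(2.10), Lemma 2.3; pp. 3–4) -/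

section Basis

/-- The formula of `U_n` before truncation: `L^{-1/2} exp(2πinx/L)`.
[cite: ConnesConsaniMoscovici2025, §2.2 eq. (2.6), p. 3] -/
def uCore (L : ℝ) (n : ℤ) (x : ℝ) : ℂ :=
  (((Real.sqrt L)⁻¹ : ℝ) : ℂ) * cexp (2 * π * I * n * x / L)

/-- **Eq. (2.6)** (p. 3): `U_n(x) := L^{-1/2} exp(2πinx/L)` for `x ∈ [0, L]`, viewed in `L¹(ℝ, dx)` by
extension by `0` outside `[0, L]` (Def. 2.1: "`L²([0, L]) ⊂ L¹(ℝ, dx)` obtained by extending functions by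
`0`").  [cite: ConnesConsaniMoscovici2025, §2.2 eq. (2.6), p. 3] -/
def uBasis (L : ℝ) (n : ℤ) : ℝ → ℂ :=
  (Icc (0 : ℝ) L).indicator (uCore L n)

/-- Pointwise product `conj U_m · U_n = L⁻¹ exp(2πi(n − m)x/L)` on the core formulas (the integrand of the
orthonormality relations of the basis (2.6)). [cite: ConnesConsaniMoscovici2025, §2.2 eq. (2.6), p. 3] -/
theorem conj_uCore_mul_uCore {L : ℝ} (hL : 0 < L) (m n : ℤ) (x : ℝ) :
    conj (uCore L m x) * uCore L n x = ((L⁻¹ : ℝ) : ℂ) * cexp (2 * π * I * (n - m) * x / L) := by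
  unfold uCore
  rw [map_mul, Complex.conj_ofReal, ← Complex.exp_conj]
  have hc : conj (2 * π * I * m * x / L) = -(2 * π * I * m * x / L) := by
    simp only [map_div₀, map_mul, map_ofNat, Complex.conj_ofReal, Complex.conj_I, map_intCast]
    ring
  rw [hc, mul_mul_mul_comm, ← Complex.exp_add, ← Complex.ofReal_mul, ← mul_inv,
    Real.mul_self_sqrt hL.le]
  congr 2
  ring

/-- **"A natural orthonormal basis for `L²([0, L])`"** (p. 3): orthonormality of the `U_n`,
`∫ conj U_m · U_n = δ_{mn}` (completeness — i.e. that they form a basis — is Mathlib's `fourierBasis` on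
`AddCircle L` and is not re-typed here). [cite: ConnesConsaniMoscovici2025, §2.2 eq. (2.6), p. 3] -/
theorem integral_conj_uBasis_mul_uBasis {L : ℝ} (hL : 0 < L) (m n : ℤ) :
    ∫ x : ℝ, conj (uBasis L m x) * uBasis L n x = if m = n then 1 else 0 := by
  have hind : (fun x : ℝ => conj (uBasis L m x) * uBasis L n x) =
      (Icc (0 : ℝ) L).indicator (fun x => ((L⁻¹ : ℝ) : ℂ) * cexp (2 * π * I * (n - m) * x / L)) := by
    funext x
    by_cases hx : x ∈ Icc (0 : ℝ) L
    · simp only [uBasis, indicator_of_mem hx, conj_uCore_mul_uCore hL]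
    · simp only [uBasis, indicator_of_notMem hx, map_zero, zero_mul]
  rw [hind, integral_indicator measurableSet_Icc, integral_Icc_eq_integral_Ioc,
    ← intervalIntegral.integral_of_le hL.le, intervalIntegral.integral_const_mul]
  have hL' : (L : ℂ) ≠ 0 := by exact_mod_cast hL.ne'
  by_cases hmn : m = n
  · subst hmn
    simp only [sub_self, mul_zero, zero_mul, zero_div, Complex.exp_zero, intervalIntegral.integral_const,
      sub_zero, Complex.real_smul, mul_one, if_true]
    push_cast
    field_simp
  · rw [if_neg hmn]
    have hc : (2 * π * I * (n - m) / L : ℂ) ≠ 0 := by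
      have hnm : ((n : ℂ) - m) ≠ 0 := by
        rw [sub_ne_zero]
        exact_mod_cast (Ne.symm hmn)
      have hpi : (π : ℂ) ≠ 0 := by exact_mod_cast Real.pi_ne_zero
      exact div_ne_zero (mul_ne_zero (mul_ne_zero (mul_ne_zero two_ne_zero hpi) I_ne_zero) hnm) hL'
    have hfun : (fun x : ℝ => cexp (2 * π * I * (n - m) * x / L)) =
        fun x : ℝ => cexp ((2 * π * I * (n - m) / L) * x) := by
      funext x; congr 1; ring
    rw [hfun, integral_exp_mul_complex hc]
    have h1 : cexp (2 * π * I * (n - m) / L * (L : ℝ)) = 1 := by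
      rw [show (2 * π * I * (n - m) / L * (L : ℝ) : ℂ) = ((n - m : ℤ) : ℂ) * (2 * π * I) by
        push_cast; field_simp]
      exact Complex.exp_int_mul_two_pi_mul_I (n - m)
    rw [h1]
    simp

/-- **Lemma 2.3's closed form** (p. 4; = (2.9) and (2.10) for `|y| ≤ L`): the even real function
`q(U_n, U_m)(y)` equals `(sin(2πm|y|/L) − sin(2πn|y|/L))/(π(n − m))` for `m ≠ n` and
`2(L − |y|) cos(2πn|y|/L)/L` for `m = n`. [cite: ConnesConsaniMoscovici2025, §2.2 Lemma 2.3 and eqs. (2.9)–(2.10), p. 4] -/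
def qBasisClosedForm (L : ℝ) (n m : ℤ) (y : ℝ) : ℝ :=
  if m = n then 2 * (L - |y|) * Real.cos (2 * π * n * |y| / L) / L
  else (Real.sin (2 * π * m * |y| / L) - Real.sin (2 * π * n * |y| / L)) / (π * (n - m))

/-- `conj U_n(−u) = U_n(u)` on the core formulas (conjugation flips the phase; first display of the
proof of (2.7): `U_m*(x) = conj U_m(−x)`). [cite: ConnesConsaniMoscovici2025, §2.2 proof of (2.7), p. 4] -/
theorem conj_uCore_neg (L : ℝ) (n : ℤ) (u : ℝ) : conj (uCore L n (-u)) = uCore L n u := by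
  unfold uCore
  rw [map_mul, Complex.conj_ofReal, ← Complex.exp_conj]
  congr 2
  simp only [map_div₀, map_mul, map_ofNat, map_neg, Complex.conj_ofReal, Complex.conj_I, map_intCast,
    Complex.ofReal_neg]
  ring

/-- `U_n(u) U_m(y − u) = L⁻¹ e^{2πimy/L} e^{2πi(n−m)u/L}` on the core formulas (the integrand of (2.7),
first display of p. 4). [cite: ConnesConsaniMoscovici2025, §2.2 proof of (2.7), p. 4] -/
theorem uCore_mul_uCore {L : ℝ} (hL : 0 < L) (n m : ℤ) (u y : ℝ) :
    uCore L n u * uCore L m (y - u) =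
      ((L⁻¹ : ℝ) : ℂ) * (cexp (2 * π * I * m * y / L) * cexp (2 * π * I * (n - m) * u / L)) := by
  unfold uCore
  rw [mul_mul_mul_comm, ← Complex.ofReal_mul, ← mul_inv, Real.mul_self_sqrt hL.le, ← Complex.exp_add,
    ← Complex.exp_add]
  congr 2
  push_cast
  ring

/-- The integrand of `(U_n* ∗ U_m)(y)`, `y ∈ [0, L]`, is supported on `u ∈ [y − L, 0]` ("`∫_y^L`" after
`x = y − u`, p. 4). [cite: ConnesConsaniMoscovici2025, §2.2 proof of (2.7), p. 4] -/
theorem weilReflect_uBasis_mul_uBasis {L : ℝ} (hL : 0 < L) (n m : ℤ) {y : ℝ} (hy : y ∈ Icc 0 L) (u : ℝ) :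
    weilReflect (uBasis L n) u * uBasis L m (y - u) =
      (Icc (y - L) 0).indicator
        (fun u => ((L⁻¹ : ℝ) : ℂ) * (cexp (2 * π * I * m * y / L) * cexp (2 * π * I * (n - m) * u / L))) u := by
  rw [mem_Icc] at hy
  simp only [weilReflect, uBasis]
  by_cases hu : u ∈ Icc (y - L) 0
  · have hu' := hu
    rw [mem_Icc] at hu'
    have h1 : -u ∈ Icc (0 : ℝ) L := by rw [mem_Icc]; constructor <;> linarith
    have h2 : y - u ∈ Icc (0 : ℝ) L := by rw [mem_Icc]; constructor <;> linarith
    rw [indicator_of_mem h1, indicator_of_mem h2, indicator_of_mem hu, conj_uCore_neg,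
      uCore_mul_uCore hL]
  · rw [indicator_of_notMem hu]
    rw [mem_Icc, not_and_or, not_le, not_le] at hu
    rcases hu with h | h
    · have h2 : y - u ∉ Icc (0 : ℝ) L := by
        rw [mem_Icc, not_and_or, not_le, not_le]; right; linarith
      rw [indicator_of_notMem h2, mul_zero]
    · have h1 : -u ∉ Icc (0 : ℝ) L := by
        rw [mem_Icc, not_and_or, not_le, not_le]; left; linarith
      rw [indicator_of_notMem h1, map_zero, zero_mul]

/-- `(U_n* ∗ U_m)(y) = L⁻¹ e^{2πimy/L} ∫_{y−L}^0 e^{2πi(n−m)u/L} du` for `y ∈ [0, L]` (the second display of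
p. 4, after `x = y − u`). [cite: ConnesConsaniMoscovici2025, §2.2 proof of (2.7), p. 4] -/
theorem weilConv_uBasis_eq_intervalIntegral {L : ℝ} (hL : 0 < L) (n m : ℤ) {y : ℝ} (hy : y ∈ Icc 0 L) :
    weilConv (weilReflect (uBasis L n)) (uBasis L m) y =
      ((L⁻¹ : ℝ) : ℂ) * cexp (2 * π * I * m * y / L) *
        ∫ u in (y - L)..0, cexp (2 * π * I * (n - m) * u / L) := by
  have hy' := hy
  rw [mem_Icc] at hy'
  rw [weilConv_apply]
  simp_rw [weilReflect_uBasis_mul_uBasis hL n m hy]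
  rw [integral_indicator measurableSet_Icc, integral_Icc_eq_integral_Ioc,
    ← intervalIntegral.integral_of_le (by linarith), intervalIntegral.integral_const_mul,
    intervalIntegral.integral_const_mul]
  ring

/-- **(2.10), convolution form** (p. 4): `(U_n* ∗ U_n)(y) = (1 − y/L) e^{2πiny/L}` for `y ∈ [0, L]`.  PROVED.
[cite: ConnesConsaniMoscovici2025, §2.2 display before (2.10), p. 4] -/
theorem ConnesConsaniMoscovici2025_eq_2_10_conv {L : ℝ} (hL : 0 < L) (n : ℤ) {y : ℝ} (hy : y ∈ Icc 0 L) :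
    weilConv (weilReflect (uBasis L n)) (uBasis L n) y =
      ((1 - y / L : ℝ) : ℂ) * cexp (2 * π * I * n * y / L) := by
  rw [weilConv_uBasis_eq_intervalIntegral hL n n hy]
  simp only [sub_self, mul_zero, zero_mul, zero_div, Complex.exp_zero, intervalIntegral.integral_const,
    zero_sub, Complex.real_smul, mul_one]
  have hL' : (L : ℂ) ≠ 0 := by exact_mod_cast hL.ne'
  push_cast
  field_simp
  ring

/-- **Eq. (2.7)** (p. 4): for `n ≠ m` and `y ∈ [0, L]`,
`(U_m* ∗ U_n)(y) = (e^{2πimy/L} − e^{2πiny/L})/(2πi(n − m))`.  PROVED.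
[cite: ConnesConsaniMoscovici2025, §2.2 eq. (2.7), p. 4] -/
theorem ConnesConsaniMoscovici2025_eq_2_7 {L : ℝ} (hL : 0 < L) {n m : ℤ} (hnm : n ≠ m) {y : ℝ}
    (hy : y ∈ Icc 0 L) :
    weilConv (weilReflect (uBasis L m)) (uBasis L n) y =
      (cexp (2 * π * I * m * y / L) - cexp (2 * π * I * n * y / L)) / (2 * π * I * (n - m)) := by
  rw [weilConv_uBasis_eq_intervalIntegral hL m n hy]
  have hL' : (L : ℂ) ≠ 0 := by exact_mod_cast hL.ne'
  have hnm' : ((m : ℂ) - n) ≠ 0 := by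
    rw [sub_ne_zero]
    exact_mod_cast (Ne.symm hnm)
  have hnm'' : ((n : ℂ) - m) ≠ 0 := by
    rw [sub_ne_zero]
    exact_mod_cast hnm
  have hpi : (π : ℂ) ≠ 0 := by exact_mod_cast Real.pi_ne_zero
  have hc : (2 * π * I * (m - n) / L : ℂ) ≠ 0 :=
    div_ne_zero (mul_ne_zero (mul_ne_zero (mul_ne_zero two_ne_zero hpi) I_ne_zero) hnm') hL'
  have hfun : (fun u : ℝ => cexp (2 * π * I * (m - n) * u / L)) =
      fun u : ℝ => cexp ((2 * π * I * (m - n) / L) * u) := by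
    funext u; congr 1; ring
  rw [hfun, integral_exp_mul_complex hc]
  have hper : cexp (2 * π * I * (m - n) / L * ((y - L : ℝ) : ℂ)) =
      cexp (2 * π * I * (m - n) / L * y) := by
    have e : (2 * π * I * (m - n) / L * ((y - L : ℝ) : ℂ) : ℂ) =
        2 * π * I * (m - n) / L * y - ((m - n : ℤ) : ℂ) * (2 * π * I) := by
      rw [Complex.ofReal_sub, mul_sub, show (2 * π * I * ((m : ℂ) - n) / L * (L : ℂ)) =
        ((m - n : ℤ) : ℂ) * (2 * π * I) by rw [div_mul_cancel₀ _ hL']; push_cast; ring]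
    rw [e, Complex.exp_sub, Complex.exp_int_mul_two_pi_mul_I, div_one]
  rw [hper]
  have hsub : cexp (2 * π * I * (m - n) / L * y) =
      cexp (2 * π * I * m * y / L) / cexp (2 * π * I * n * y / L) := by
    rw [← Complex.exp_sub]
    congr 1
    ring
  simp only [Complex.ofReal_zero, mul_zero, Complex.exp_zero]
  rw [hsub]
  have he : cexp (2 * π * I * n * y / L) ≠ 0 := Complex.exp_ne_zero _
  have hI : I ≠ 0 := I_ne_zero
  push_cast
  field_simp
  ring

/-- `e^{iθ} − e^{−iθ} = 2i sin θ`. [folklore] -/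
private theorem cexp_mul_I_sub_cexp_neg (θ : ℝ) :
    cexp (θ * I) - cexp (-(θ * I)) = 2 * I * Real.sin θ := by
  rw [show -((θ : ℂ) * I) = ((-θ : ℝ) : ℂ) * I by push_cast; ring, Complex.exp_mul_I,
    Complex.exp_mul_I]
  push_cast
  rw [Complex.cos_neg, Complex.sin_neg, ← Complex.ofReal_sin]
  ring

/-- **Lemma 2.3** on `[0, L]` (p. 4): `q(U_n, U_m)(y) = qBasisClosedForm L n m y` — i.e. (2.8)/(2.9) for
`m ≠ n` and (2.10) for `m = n` — from (2.7) and the corrected (2.5) (`q = C + conj C`).  PROVED.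
[cite: ConnesConsaniMoscovici2025, §2.2 Lemma 2.3, eqs. (2.8)–(2.10), p. 4] -/
theorem ConnesConsaniMoscovici2025_lemma_2_3_of_mem_Icc {L : ℝ} (hL : 0 < L) (n m : ℤ) {y : ℝ}
    (hy : y ∈ Icc 0 L) :
    qForm (uBasis L n) (uBasis L m) y = (qBasisClosedForm L n m y : ℂ) := by
  have hy' := hy
  rw [mem_Icc] at hy'
  have habs : |y| = y := abs_of_nonneg hy'.1
  have hL' : (L : ℂ) ≠ 0 := by exact_mod_cast hL.ne'
  have hpi : (π : ℂ) ≠ 0 := by exact_mod_cast Real.pi_ne_zero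
  rw [qForm_eq]
  unfold qBasisClosedForm
  rw [habs]
  by_cases hmn : m = n
  · subst hmn
    rw [if_pos rfl, ConnesConsaniMoscovici2025_eq_2_10_conv hL m hy, map_mul, Complex.conj_ofReal,
      ← Complex.exp_conj,
      show (2 * π * I * m * y / L : ℂ) = ((2 * π * m * y / L : ℝ) : ℂ) * I by push_cast; field_simp,
      show conj (((2 * π * m * y / L : ℝ) : ℂ) * I) = -(((2 * π * m * y / L : ℝ) : ℂ) * I) by
        rw [map_mul, Complex.conj_ofReal, Complex.conj_I]; ring,
      ← mul_add, show -(((2 * π * m * y / L : ℝ) : ℂ) * I) = ((-(2 * π * m * y / L) : ℝ) : ℂ) * I by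
        push_cast; ring,
      Complex.exp_mul_I, Complex.exp_mul_I]
    simp only [← Complex.ofReal_cos, ← Complex.ofReal_sin, Real.cos_neg, Real.sin_neg]
    push_cast
    field_simp
    ring
  · rw [if_neg hmn, ConnesConsaniMoscovici2025_eq_2_7 hL (Ne.symm hmn) hy,
      ConnesConsaniMoscovici2025_eq_2_7 hL hmn hy, map_div₀, map_sub, ← Complex.exp_conj,
      ← Complex.exp_conj]
    have e1 : ∀ k : ℤ, (2 * π * I * k * y / L : ℂ) = ((2 * π * k * y / L : ℝ) : ℂ) * I := by
      intro k; push_cast; field_simp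
    have e2 : ∀ k : ℤ, conj (((2 * π * k * y / L : ℝ) : ℂ) * I) = -(((2 * π * k * y / L : ℝ) : ℂ) * I) := by
      intro k; rw [map_mul, Complex.conj_ofReal, Complex.conj_I]; ring
    have e3 : conj (2 * π * I * ((n : ℂ) - m)) = -(2 * π * I * (n - m)) := by
      simp only [map_mul, map_sub, map_ofNat, Complex.conj_ofReal, Complex.conj_I, map_intCast]; ring
    rw [e1 m, e1 n, e2, e2, e3]
    have hmn' : ((m : ℂ) - n) ≠ 0 := by
      rw [sub_ne_zero]; exact_mod_cast hmn
    have hnm' : ((n : ℂ) - m) ≠ 0 := by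
      rw [sub_ne_zero]; exact_mod_cast (Ne.symm hmn)
    rw [show (cexp (((2 * π * n * y / L : ℝ) : ℂ) * I) - cexp (((2 * π * m * y / L : ℝ) : ℂ) * I)) /
          (2 * π * I * (m - n)) +
        (cexp (-(((2 * π * m * y / L : ℝ) : ℂ) * I)) - cexp (-(((2 * π * n * y / L : ℝ) : ℂ) * I))) /
          -(2 * π * I * (n - m)) =
        ((cexp (((2 * π * m * y / L : ℝ) : ℂ) * I) - cexp (-(((2 * π * m * y / L : ℝ) : ℂ) * I))) -
          (cexp (((2 * π * n * y / L : ℝ) : ℂ) * I) - cexp (-(((2 * π * n * y / L : ℝ) : ℂ) * I)))) /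
          (2 * π * I * (n - m)) by field_simp; ring,
      cexp_mul_I_sub_cexp_neg, cexp_mul_I_sub_cexp_neg]
    have hI : I ≠ 0 := I_ne_zero
    push_cast
    field_simp

/-- **Lemma 2.3 with (2.7)–(2.10)** (p. 4), PROVED: for `L > 0`, `n, m ∈ ℤ` and `|y| ≤ L`,
`q(U_n, U_m)(y) = qBasisClosedForm L n m y`, i.e. `(sin(2πm|y|/L) − sin(2πn|y|/L))/(π(n−m))` for `m ≠ n`
and `2(1 − |y|/L) cos(2πny/L)` for `m = n` (Lemma 2.3 states the `y ∈ [0, L]` half; (2.9)–(2.10) the even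
extension to `[−L, L]`, which follows from `qForm_neg`).  RH-FREE.
[cite: ConnesConsaniMoscovici2025, §2.2 Lemma 2.3, eqs. (2.7)–(2.10), p. 4] -/
theorem ConnesConsaniMoscovici2025_lemma_2_3 {L : ℝ} (hL : 0 < L) (n m : ℤ) {y : ℝ} (hy : |y| ≤ L) :
    qForm (uBasis L n) (uBasis L m) y = (qBasisClosedForm L n m y : ℂ) := by
  rcases le_or_gt 0 y with h | h
  · exact ConnesConsaniMoscovici2025_lemma_2_3_of_mem_Icc hL n m ⟨h, (le_abs_self y).trans hy⟩
  · have hqc : qBasisClosedForm L n m y = qBasisClosedForm L n m (-y) := by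
      simp only [qBasisClosedForm, abs_neg]
    rw [← qForm_neg, hqc]
    exact ConnesConsaniMoscovici2025_lemma_2_3_of_mem_Icc hL n m ⟨by linarith, by rwa [abs_of_neg h] at hy⟩

end Basis

/-! ## §3 The Weil functional `Ψ`, its one-sided form `Ψ♯`, and Lemma 3.1 (pp. 5–7) -/

section Psi

/-- **Eq. (3.10)** (p. 6): the Weil functional `Ψ(F) := W_{0,2}(F) − W_ℝ(F) − Σ_p W_p(F)` with `W_ℝ` in
Bombieri's form (3.4), written for the additive avatar `k` (`F = k ∘ log`): `ĝ(0) + ĝ(1)`, minus the von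
Mangoldt sum, plus `archW k = −W_ℝ(F)`.  Equals the tree's `weilFunctional k` (digamma form of the
archimedean term) on test functions: `psiFunctional_eq_weilFunctional`.
[cite: ConnesConsaniMoscovici2025, §3 eq. (3.10), p. 6] -/
def psiFunctional (k : ℝ → ℂ) : ℂ :=
  weilPolarTerm k - weilPrimeTerm k + archW k

/-- `Ψ = W` on test functions: the two printed forms of the archimedean distribution ((3.4) Bombieri,
(3.8) `W_ℝ = −W_∞` via `θ′`) agree — the tree's PROVED `weilArchTermBombieri_eq_weilArchTerm_holds`.
[cite: ConnesConsaniMoscovici2025, §3 eqs. (3.4), (3.8), pp. 5–6] -/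
theorem psiFunctional_eq_weilFunctional {k : ℝ → ℂ} (hk : IsWeilTest k) :
    psiFunctional k = weilFunctional k := by
  unfold psiFunctional weilFunctional archW
  rw [weilArchTermBombieri_eq_weilArchTerm_holds hk]

/-- **(3.10)** `QW(f, g) := Ψ(f* ∗ g)`, the Weil sesquilinear form (antilinear in `f`).
[cite: ConnesConsaniMoscovici2025, §3 eq. (3.10), p. 6] -/
def weilSesqForm (f g : ℝ → ℂ) : ℂ :=
  psiFunctional (weilConv (weilReflect f) g)

/-- Commutativity of the additive convolution (the group `ℝ` is abelian; Mathlib `convolution_flip` with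
`ContinuousLinearMap.flip_mul`; private copy as in `ArchimedeanSoninTrace.lean`). [folklore] -/
private theorem weilConv_comm (f g : ℝ → ℂ) : weilConv f g = weilConv g f := by
  have h := convolution_flip (L := ContinuousLinearMap.mul ℂ ℂ) (μ := (volume : Measure ℝ))
    (f := f) (g := g)
  rw [ContinuousLinearMap.flip_mul] at h
  exact h.symm

/-- On the diagonal the paper's `QW(f, f) = Ψ(f* ∗ f)` IS the tree's `weilQuadratic f = W(f ⋆ f*)`
(test functions; `f* ∗ f = f ∗ f*`). [cite: ConnesConsaniMoscovici2025, §3 eq. (3.10), p. 6] -/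
theorem weilSesqForm_self {f : ℝ → ℂ} (hf : IsWeilTest f) : weilSesqForm f f = weilQuadratic f := by
  unfold weilSesqForm weilQuadratic
  rw [weilConv_comm, psiFunctional_eq_weilFunctional (hf.weilConv hf.weilReflect)]

/-- **(3.12)** `h + h∘ι` in the additive variable: `t ↦ k(t) + k(−t)`.
[cite: ConnesConsaniMoscovici2025, §3 Lemma 3.1 eq. (3.12), p. 6] -/
def symmetrize (k : ℝ → ℂ) : ℝ → ℂ :=
  fun t => k t + k (-t)

/-- `q(f, g) = h + h∘ι` with `h = f* ∗ g` (p. 7, proof of Prop. 3.2 (ii)): definitional.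
[cite: ConnesConsaniMoscovici2025, §3 proof of Prop. 3.2 (ii), p. 7] -/
theorem qForm_eq_symmetrize (f g : ℝ → ℂ) : qForm f g = symmetrize (weilConv (weilReflect f) g) :=
  rfl

/-- **(3.14)** `W♯_{0,2}(F) := ∫₁^∞ F(x)(x^{1/2} + x^{-1/2}) d*x`, additively `∫₀^∞ G(t)(e^{t/2} + e^{-t/2}) dt`.
[cite: ConnesConsaniMoscovici2025, §3 eq. (3.14), p. 7] -/
def psiSharpPolar (G : ℝ → ℂ) : ℂ :=
  ∫ t in Ioi (0 : ℝ), G t * ((Real.exp (t / 2) + Real.exp (-(t / 2)) : ℝ) : ℂ)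

/-- **(3.15)** `W♯_ℝ(F) := ½(log 4π + γ) F(1) + ∫₁^∞ (x^{1/2} F(x) − F(1))/(x − x⁻¹) d*x` ("note the factor
`½`"), additively `½(log 4π + γ) G(0) + ∫₀^∞ (e^{t/2} G(t) − G(0))/(e^t − e^{-t}) dt`.
[cite: ConnesConsaniMoscovici2025, §3 eq. (3.15), p. 7] -/
def psiSharpArch (G : ℝ → ℂ) : ℂ :=
  (1 / 2 : ℂ) * (Real.log (4 * π) + Real.eulerMascheroniConstant : ℂ) * G 0 +
    ∫ t in Ioi (0 : ℝ), ((Real.exp (t / 2) : ℂ) * G t - G 0) / ((Real.exp t - Real.exp (-t) : ℝ) : ℂ)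

/-- **(3.16)** `W♯_p(F) := (log p) Σ_{m ≥ 1} p^{-m/2} F(p^m)`, summed over the primes and written with von
Mangoldt's function (as the tree's `weilPrimeTerm`): `Σ_p W♯_p(F) = Σ_n Λ(n) n^{-1/2} G(log n)`.
[cite: ConnesConsaniMoscovici2025, §3 eq. (3.16), p. 7] -/
def psiSharpPrime (G : ℝ → ℂ) : ℂ :=
  ∑' n : ℕ, ((Λ n : ℝ) : ℂ) / (Real.sqrt n : ℂ) * G (Real.log n)

/-- **(3.13)** the distribution on `[1, ∞)` (additively `[0, ∞)`) `Ψ♯ := W♯_{0,2} − W♯_ℝ − Σ_p W♯_p`.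
[cite: ConnesConsaniMoscovici2025, §3 eq. (3.13), p. 6] -/
def psiSharp (G : ℝ → ℂ) : ℂ :=
  psiSharpPolar G - psiSharpArch G - psiSharpPrime G

/-- The polar part of Lemma 3.1: `ĝ(0) + ĝ(1) = ∫₀^∞ (k(t) + k(−t))(e^{t/2} + e^{-t/2}) dt` for `k`
continuous with compact support. [cite: ConnesConsaniMoscovici2025, §3 Lemma 3.1 (proof), p. 7] -/
theorem weilPolarTerm_eq_psiSharpPolar {k : ℝ → ℂ} (hk : Continuous k) (hks : HasCompactSupport k) :
    weilPolarTerm k = psiSharpPolar (symmetrize k) := by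
  -- the weight `w(t) = e^{t/2} + e^{-t/2}` (real, even, continuous)
  set w : ℝ → ℝ := fun t => Real.exp (t / 2) + Real.exp (-(t / 2)) with hw
  have hwc : Continuous w := by fun_prop
  have hw_even : ∀ t, w (-t) = w t := by
    intro t
    simp only [hw, neg_div, neg_neg]
    exact add_comm _ _
  have hint : Integrable fun t : ℝ => k t * ((w t : ℝ) : ℂ) :=
    (hk.mul (continuous_ofReal.comp hwc)).integrable_of_hasCompactSupport hks.mul_right
  have hint' : Integrable fun t : ℝ => k (-t) * ((w t : ℝ) : ℂ) := by
    have hkn : Continuous fun t : ℝ => k (-t) := hk.comp continuous_neg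
    have hksn : HasCompactSupport fun t : ℝ => k (-t) := hks.comp_homeomorph (Homeomorph.neg ℝ)
    exact (hkn.mul (continuous_ofReal.comp hwc)).integrable_of_hasCompactSupport hksn.mul_right
  -- Step 1: `ĝ(0) + ĝ(1) = ∫_ℝ k(t) w(t) dt`
  have h0 : ∀ t : ℝ, cexp ((0 - 1 / 2) * (t : ℂ)) = ((Real.exp (-(t / 2)) : ℝ) : ℂ) := by
    intro t
    rw [Complex.ofReal_exp]
    congr 1
    push_cast
    ring
  have h1 : ∀ t : ℝ, cexp ((1 - 1 / 2) * (t : ℂ)) = ((Real.exp (t / 2) : ℝ) : ℂ) := by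
    intro t
    rw [Complex.ofReal_exp]
    congr 1
    push_cast
    ring
  have hsum : weilPolarTerm k = ∫ t : ℝ, k t * ((w t : ℝ) : ℂ) := by
    unfold weilPolarTerm weilMellin
    simp_rw [h0, h1]
    rw [← integral_add]
    · congr 1
      funext t
      simp only [hw]
      push_cast
      ring
    · exact (hk.mul (continuous_ofReal.comp (by fun_prop))).integrable_of_hasCompactSupport
        hks.mul_right
    · exact (hk.mul (continuous_ofReal.comp (by fun_prop))).integrable_of_hasCompactSupport
        hks.mul_right
  -- Step 2: split `ℝ = (0, ∞) ∪ (−∞, 0]` and reflect the second piece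
  rw [hsum, ← integral_add_compl (measurableSet_Ioi (a := (0 : ℝ))) hint, Set.compl_Ioi]
  have hrefl : ∫ t in Iic (0 : ℝ), k t * ((w t : ℝ) : ℂ) = ∫ t in Ioi (0 : ℝ), k (-t) * ((w t : ℝ) : ℂ) := by
    have h := integral_comp_neg_Ioi (c := (0 : ℝ)) (fun t : ℝ => k t * ((w t : ℝ) : ℂ))
    simp only [neg_zero] at h
    rw [← h]
    refine setIntegral_congr_fun measurableSet_Ioi fun t _ => ?_
    simp only [hw_even]
  rw [hrefl, ← integral_add hint.integrableOn hint'.integrableOn]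
  unfold psiSharpPolar symmetrize
  refine setIntegral_congr_fun measurableSet_Ioi fun t _ => ?_
  simp only [hw]
  ring

/-- The prime part of Lemma 3.1 is definitional: `Σ Λ(n) n^{-1/2}(k(log n) + k(−log n)) = Σ_p W♯_p(k + k∘ι)`.
[cite: ConnesConsaniMoscovici2025, §3 Lemma 3.1 (proof), p. 7] -/
theorem weilPrimeTerm_eq_psiSharpPrime (k : ℝ → ℂ) :
    weilPrimeTerm k = psiSharpPrime (symmetrize k) :=
  rfl

/-- The archimedean part of Lemma 3.1: `−W_∞(k) = W♯_ℝ(k + k∘ι)` — the integrands agree pointwise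
(`2 sinh t = e^t − e^{-t}`, "note the factor `½` in (3.15)").  No hypothesis on `k`.
[cite: ConnesConsaniMoscovici2025, §3 Lemma 3.1 (proof), eq. (3.15), p. 7] -/
theorem psiSharpArch_symmetrize (k : ℝ → ℂ) : psiSharpArch (symmetrize k) = -archW k := by
  unfold psiSharpArch symmetrize archW weilArchTermBombieri
  simp only [neg_zero, neg_neg]
  have hint : (fun t : ℝ => ((Real.exp (t / 2) : ℂ) * (k t + k (-t)) - (k 0 + k 0)) /
        ((Real.exp t - Real.exp (-t) : ℝ) : ℂ)) =
      fun t : ℝ => ((Real.exp (t / 2) : ℂ) * (k t + k (-t)) - 2 * k 0) / (2 * Real.sinh t : ℂ) := by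
    funext t
    rw [Real.sinh_eq]
    push_cast
    ring_nf
  rw [hint]
  ring

/-- **Lemma 3.1** (p. 6): "The Weil functional `Ψ` fulfills `Ψ(h) = Ψ♯(h) + Ψ♯(h∘ι) = Ψ♯(h + h∘ι)`, where
`Ψ♯ = W♯_{0,2} − W♯_ℝ − Σ W♯_p` is the distribution on `[1, ∞)` with components (3.14)–(3.16)."  PROVED
for every continuous compactly supported kernel `k` (additive avatar of `h`); see the module docstring
for the hypothesis.  RH-FREE. [cite: ConnesConsaniMoscovici2025, §3 Lemma 3.1 eqs. (3.12)–(3.16), pp. 6–7] -/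
theorem ConnesConsaniMoscovici2025_lemma_3_1 {k : ℝ → ℂ} (hk : Continuous k) (hks : HasCompactSupport k) :
    psiFunctional k = psiSharp (symmetrize k) := by
  unfold psiFunctional psiSharp
  rw [weilPolarTerm_eq_psiSharpPolar hk hks, weilPrimeTerm_eq_psiSharpPrime, psiSharpArch_symmetrize]
  ring

end Psi

/-! ## Prop. 3.2: the isometry `κ` and `QW(κf, κg) = Ψ♯(q(f,g) ∘ log)` (p. 7) -/

section Kappa

/-- **(3.17)** `κ(f)(u) := f(log(λu))`, `u ∈ [λ⁻¹, λ]`, `L = 2 log λ`: in the additive variable `t = log u`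
this is the translation `t ↦ f(t + L/2)` carrying functions on `[0, L]` to functions on `[−L/2, L/2]`
(`= f_a` with `a = −L/2` in the notation of Lemma 2.2, as the proof of Prop. 3.2 (ii) says).
[cite: ConnesConsaniMoscovici2025, §3 Prop. 3.2 (i) eq. (3.17), p. 7] -/
def kappaShift (L : ℝ) (f : ℝ → ℂ) : ℝ → ℂ :=
  fun t => f (t + L / 2)

/-- `κ(f) = f_a` with `a = −L/2`. [cite: ConnesConsaniMoscovici2025, §3 proof of Prop. 3.2 (ii), p. 7] -/
theorem kappaShift_eq_translate (L : ℝ) (f : ℝ → ℂ) : kappaShift L f = fun t => f (t - -(L / 2)) := by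
  funext t
  simp [kappaShift, sub_neg_eq_add]

/-- **Prop. 3.2 (i)** (p. 7), additive form: `κ` is an isometry, `∫ ‖κ f‖² dt = ∫ ‖f‖² dx` (translation
invariance of `dt`; the printed isometry `L²([0, L], dx) → L²([λ⁻¹, λ], d*u)` is this statement composed
with `u = e^t`, `d*u = dt`). [cite: ConnesConsaniMoscovici2025, §3 Prop. 3.2 (i), p. 7] -/
theorem ConnesConsaniMoscovici2025_prop_3_2_i_normSq (L : ℝ) (f : ℝ → ℂ) :
    ∫ t : ℝ, ‖kappaShift L f t‖ ^ 2 = ∫ x : ℝ, ‖f x‖ ^ 2 :=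
  integral_add_right_eq_self (μ := (volume : Measure ℝ)) (fun x : ℝ => ‖f x‖ ^ 2) (L / 2)

/-- **Prop. 3.2 (i)** (p. 7), the printed change of variables itself: for `λ = e^{L/2}` and `f` continuous
on `[0, L]`, `∫_{λ⁻¹}^{λ} ‖f(log(λu))‖² du/u = ∫₀^L ‖f(x)‖² dx` ("the map `u ↦ log(λu)` is a diffeomorphism
from `[λ⁻¹, λ]` to `[0, L]` transforming `d*u` into `dx`"). [cite: ConnesConsaniMoscovici2025, §3 Prop. 3.2 (i), p. 7] -/
theorem ConnesConsaniMoscovici2025_prop_3_2_i_changeOfVariables {L : ℝ} (hL : 0 < L) {f : ℝ → ℂ}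
    (hf : Continuous f) :
    ∫ u in Real.exp (-(L / 2))..Real.exp (L / 2), ‖f (Real.log (Real.exp (L / 2) * u))‖ ^ 2 * u⁻¹ =
      ∫ x in (0 : ℝ)..L, ‖f x‖ ^ 2 := by
  set a : ℝ := Real.exp (-(L / 2)) with ha
  set b : ℝ := Real.exp (L / 2) with hb
  have ha0 : 0 < a := Real.exp_pos _
  have hab : a ≤ b := Real.exp_le_exp.mpr (by linarith)
  -- `φ(u) = log(b u)`, `φ' = u⁻¹` on `[a, b] ⊂ (0, ∞)`
  have hpos : ∀ u ∈ uIcc a b, 0 < u := by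
    intro u hu
    rw [uIcc_of_le hab] at hu
    exact ha0.trans_le hu.1
  have hderiv : ∀ u ∈ uIcc a b, HasDerivAt (fun u => Real.log (b * u)) u⁻¹ u := by
    intro u hu
    have hu0 : u ≠ 0 := (hpos u hu).ne'
    have hb0 : b ≠ 0 := (Real.exp_pos _).ne'
    have h1 : HasDerivAt (fun y : ℝ => b * y) b u := by
      simpa using (hasDerivAt_id' u).const_mul b
    have h2 := h1.log (mul_ne_zero hb0 hu0)
    rw [show b / (b * u) = u⁻¹ by field_simp] at h2
    exact h2
  have hcont : ContinuousOn (fun u : ℝ => u⁻¹) (uIcc a b) :=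
    continuousOn_inv₀.mono fun u hu => (hpos u hu).ne'
  have hg : Continuous fun x : ℝ => ‖f x‖ ^ 2 := by fun_prop
  have key : ∫ u in a..b, ‖f (Real.log (b * u))‖ ^ 2 * u⁻¹ =
      ∫ x in Real.log (b * a)..Real.log (b * b), ‖f x‖ ^ 2 :=
    intervalIntegral.integral_comp_mul_deriv hderiv hcont hg
  have hφa : Real.log (b * a) = 0 := by
    rw [hb, ha, ← Real.exp_add, Real.log_exp]; ring
  have hφb : Real.log (b * b) = L := by
    rw [hb, ← Real.exp_add, Real.log_exp]; ring
  rw [key, hφa, hφb]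

/-- `κ` preserves test functions ("induces an isomorphism `C^∞([0, L]) → C^∞([λ⁻¹, λ])`", Prop. 3.2 (i);
here on the tree's smooth class). [cite: ConnesConsaniMoscovici2025, §3 Prop. 3.2 (i), p. 7] -/
theorem IsWeilTest.kappaShift {f : ℝ → ℂ} (hf : IsWeilTest f) (L : ℝ) : IsWeilTest (kappaShift L f) :=
  ⟨hf.1.comp (contDiff_id.add contDiff_const),
    hf.2.comp_homeomorph (Homeomorph.addRight (L / 2))⟩

/-- `κ` moves supports by `−L/2`: `tsupport f ⊆ [0, L] ⇒ tsupport (κ f) ⊆ [−L/2, L/2]` (Prop. 3.2 (i):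
`κ` carries `[0, L]` onto `[λ⁻¹, λ]`, additively `[−L/2, L/2]`). [cite: ConnesConsaniMoscovici2025, §3 Prop. 3.2 (i), p. 7] -/
theorem tsupport_kappaShift_subset {L : ℝ} {f : ℝ → ℂ} (h : tsupport f ⊆ Icc 0 L) :
    tsupport (kappaShift L f) ⊆ Icc (-(L / 2)) (L / 2) := by
  have e : kappaShift L f = f ∘ Homeomorph.addRight (L / 2) := by
    funext t; simp [kappaShift]
  rw [e, tsupport_comp_eq_preimage]
  intro t ht
  have ht' := h ht
  simp only [Homeomorph.coe_addRight, mem_Icc] at ht'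
  simp only [mem_Icc]
  constructor <;> linarith [ht'.1, ht'.2]

/-- **Prop. 3.2 (ii)** (p. 7): `QW(κ(f), κ(g)) = Ψ♯(F)`, `F(u) = q(f, g)(log u)` — here for all `f, g` whose
kernel `f* ∗ g` is continuous with compact support (Lemma 2.2 removes `κ`, Lemma 3.1 folds `Ψ` to `Ψ♯`).
RH-FREE. [cite: ConnesConsaniMoscovici2025, §3 Prop. 3.2 (ii) eq. (3.18), p. 7] -/
theorem ConnesConsaniMoscovici2025_prop_3_2_ii (L : ℝ) {f g : ℝ → ℂ}
    (hk : Continuous (weilConv (weilReflect f) g)) (hks : HasCompactSupport (weilConv (weilReflect f) g)) :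
    weilSesqForm (kappaShift L f) (kappaShift L g) = psiSharp (qForm f g) := by
  unfold weilSesqForm
  rw [kappaShift_eq_translate, kappaShift_eq_translate, ConnesConsaniMoscovici2025_lemma_2_2,
    ConnesConsaniMoscovici2025_lemma_3_1 hk hks, qForm_eq_symmetrize]

/-- **Prop. 3.2 (ii)** for test functions `f, g` (the printed `f, g ∈ C^∞([0, L])` case used in §4 is the
same computation; `IsWeilTest` functions are the tree's smooth class). [cite: ConnesConsaniMoscovici2025, §3 Prop. 3.2 (ii) eq. (3.18), p. 7] -/
theorem ConnesConsaniMoscovici2025_prop_3_2_ii_of_isWeilTest (L : ℝ) {f g : ℝ → ℂ}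
    (hf : IsWeilTest f) (hg : IsWeilTest g) :
    weilSesqForm (kappaShift L f) (kappaShift L g) = psiSharp (qForm f g) :=
  have hk : IsWeilTest (weilConv (weilReflect f) g) := hf.weilReflect.weilConv hg
  ConnesConsaniMoscovici2025_prop_3_2_ii L hk.1.continuous hk.2

end Kappa

/-! ## §3.1 The quadratic form `QW_λ` ((3.19)–(3.22), Prop. 3.3; p. 8) -/

section Window

/-- **(3.20)** the matrix coefficient `⟨f | T(n) g⟩ := n^{-1/2}((f* ∗ g)(n) + (f* ∗ g)(n⁻¹))` of the bounded
self-adjoint operator `T(n)` (additively: evaluation of `f* ∗ g` at `± log n`).  Typed as the sesquilinear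
coefficient, not as an operator; symmetry is `conj_tForm`, boundedness `|(f* ∗ g)(v)| ≤ ‖f‖ ‖g‖` is
[4] Prop. 2.1 (proof). [cite: ConnesConsaniMoscovici2025, §3.1 eq. (3.20), p. 8] -/
def tForm (n : ℕ) (f g : ℝ → ℂ) : ℂ :=
  (weilConv (weilReflect f) g (Real.log n) + weilConv (weilReflect f) g (-Real.log n)) / (Real.sqrt n : ℂ)

/-- `T(n)` is symmetric: `conj ⟨g | T(n) f⟩ = ⟨f | T(n) g⟩` (from the corrected (2.5)).
[cite: ConnesConsaniMoscovici2025, §3.1 eq. (3.20) ("self-adjoint"), p. 8] -/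
theorem conj_tForm (n : ℕ) (f g : ℝ → ℂ) : conj (tForm n g f) = tForm n f g := by
  unfold tForm
  rw [map_div₀, Complex.conj_ofReal, map_add, ← weilConv_weilReflect_neg,
    show weilConv (weilReflect g) f (-Real.log n) = conj (weilConv (weilReflect f) g (Real.log n)) by
      rw [weilConv_weilReflect_neg], Complex.conj_conj, add_comm]

/-- `2∂_tθ(t) = Re ψ(1/4 + it/2) − log π` (the weight of (3.8)/(3.19); `θ` = (3.9)).
[cite: ConnesConsaniMoscovici2025, §3 eqs. (3.8)–(3.9), p. 6] -/
theorem two_mul_riemannSiegelThetaDeriv (t : ℝ) :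
    2 * riemannSiegelThetaDeriv t = (Complex.digamma (1 / 4 + t / 2 * I)).re - Real.log π := by
  unfold riemannSiegelThetaDeriv
  ring

/-- The archimedean integral in the printed variable: `∫ |F̂(t)|² 2∂_tθ(t) dt = ∫ |ĝ(1/2+it)|² (Re ψ(1/4+it/2) − log π) dt`
(`t ↦ −t`, `∂_tθ` even: `riemannSiegelThetaDeriv_neg_holds`). [cite: ConnesConsaniMoscovici2025, §3.1 eq. (3.19), p. 8] -/
theorem integral_normSq_mulFourier_mul_two_thetaDeriv (f : ℝ → ℂ) :
    ∫ t : ℝ, ‖mulFourier f t‖ ^ 2 * (2 * riemannSiegelThetaDeriv t) =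
      ∫ t : ℝ, ‖weilMellin f (1 / 2 + t * I)‖ ^ 2 *
        ((Complex.digamma (1 / 4 + t / 2 * I)).re - Real.log π) := by
  rw [← integral_neg_eq_self (μ := (volume : Measure ℝ))
    (fun t : ℝ => ‖mulFourier f t‖ ^ 2 * (2 * riemannSiegelThetaDeriv t))]
  congr 1
  funext t
  simp only [mulFourier_neg_ofReal, riemannSiegelThetaDeriv_neg_holds t,
    two_mul_riemannSiegelThetaDeriv]

/-- **Eq. (3.19)** (p. 8): for `λ > 1` and `f` supported in `[λ⁻¹, λ]`,
`QW_λ(f, f) = ∫ |F̂(t)|² 2∂_tθ(t) dt/(2π) + 2 Re(F̂(i/2) conj F̂(−i/2)) − Σ_{1 < n ≤ λ²} Λ(n) ⟨f | T(n) f⟩`.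
PROVED in the tree's normalisation, in the "integer ceiling" form: for a test function `f` with
`tsupport f ⊆ [−(log (N+1))/2, (log (N+1))/2]` (i.e. `λ² < N + 1`) the sum runs over `n ≤ N`; the terms
`n = 0, 1` vanish (`Λ = 0`), so this is the printed `Σ_{1 < n ≤ λ²}` with `N = ⌊λ²⌋`.  Ingredients (all in the
tree): the explicit decomposition `W = polar − prime + arch`, `(f ⋆ f*)^(1/2+it) = |f̂(1/2+it)|²`,
Plancherel `∫|f̂(1/2+it)|² dt = 2π‖f‖₂²`, and the finite prime sum on the window.  RH-FREE.
[cite: ConnesConsaniMoscovici2025, §3.1 eqs. (3.19)–(3.20), p. 8] -/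
theorem ConnesConsaniMoscovici2025_eq_3_19 {f : ℝ → ℂ} (hf : IsWeilTest f) (N : ℕ)
    (hsupp : tsupport f ⊆ Icc (-(Real.log ((N : ℝ) + 1) / 2)) (Real.log ((N : ℝ) + 1) / 2)) :
    weilQuadratic f =
      (((1 / (2 * π)) * ∫ t : ℝ, ‖mulFourier f t‖ ^ 2 * (2 * riemannSiegelThetaDeriv t) : ℝ) : ℂ)
        + ((2 * (mulFourier f (I / 2) * conj (mulFourier f (-(I / 2)))).re : ℝ) : ℂ)
        - ∑ n ∈ Finset.range (N + 1), ((Λ n : ℝ) : ℂ) * tForm n f f := by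
  set K : ℝ → ℂ := weilConv f (weilReflect f) with hKdef
  have hK : IsWeilTest K := hf.weilConv hf.weilReflect
  have hKs : tsupport K ⊆ Icc (-Real.log ((N : ℝ) + 1)) (Real.log ((N : ℝ) + 1)) := by
    have h := tsupport_weilConv_weilReflect_subset (a := Real.log ((N : ℝ) + 1) / 2) hf.2 hsupp
    rwa [show 2 * (Real.log ((N : ℝ) + 1) / 2) = Real.log ((N : ℝ) + 1) by ring] at h
  -- polar term
  have hpol : weilPolarTerm K =
      ((2 * (mulFourier f (I / 2) * conj (mulFourier f (-(I / 2)))).re : ℝ) : ℂ) := by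
    rw [hKdef, weilPolarTerm_weilConv_weilReflect hf, mulFourier_I_half, mulFourier_neg_I_half]
    congr 2
    simp only [Complex.mul_re, Complex.conj_re, Complex.conj_im]
    ring
  -- prime term
  have hprime : weilPrimeTerm K = ∑ n ∈ Finset.range (N + 1), ((Λ n : ℝ) : ℂ) * tForm n f f := by
    rw [weilPrimeTerm_eq_sum_of_tsupport_subset hK.1.continuous N hKs]
    refine Finset.sum_congr rfl fun n _ => ?_
    unfold tForm
    rw [weilConv_comm (weilReflect f) f, ← hKdef]
    ring
  -- archimedean term
  have harch : weilArchTerm K =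
      (((1 / (2 * π)) * ∫ t : ℝ, ‖mulFourier f t‖ ^ 2 * (2 * riemannSiegelThetaDeriv t) : ℝ) : ℂ) := by
    rw [integral_normSq_mulFourier_mul_two_thetaDeriv]
    have hi1 : Integrable fun t : ℝ =>
        ‖weilMellin f (1 / 2 + t * I)‖ ^ 2 * (Complex.digamma (1 / 4 + t / 2 * I)).re :=
      integrable_norm_sq_weilMellin_mul_reDigammaQuarter hf
    have hi2 := integrable_norm_sq_weilMellin_half_line hf
    have hsplit : ∫ t : ℝ, ‖weilMellin f (1 / 2 + t * I)‖ ^ 2 *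
          ((Complex.digamma (1 / 4 + t / 2 * I)).re - Real.log π) =
        (∫ t : ℝ, ‖weilMellin f (1 / 2 + t * I)‖ ^ 2 * (Complex.digamma (1 / 4 + t / 2 * I)).re) -
          Real.log π * ∫ t : ℝ, ‖weilMellin f (1 / 2 + t * I)‖ ^ 2 := by
      rw [← integral_const_mul, ← integral_sub hi1 (hi2.const_mul _)]
      congr 1
      funext t
      ring
    rw [hsplit, integral_norm_sq_weilMellin_half_line hf]
    unfold weilArchTerm weilNorm2Sq
    rw [hKdef, weilArchIntegral_weilConv_weilReflect hf, weilConv_weilReflect_apply_zero]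
    have hpi : (π : ℂ) ≠ 0 := by exact_mod_cast Real.pi_ne_zero
    set A : ℝ := ∫ t : ℝ, ‖weilMellin f (1 / 2 + t * I)‖ ^ 2 * (Complex.digamma (1 / 4 + t / 2 * I)).re
    set B : ℝ := ∫ t : ℝ, ‖f t‖ ^ 2
    push_cast
    field_simp
  unfold weilQuadratic weilFunctional
  rw [← hKdef, hpol, hprime, harch]
  ring

/-- **Prop. 3.3** (p. 8; "([4, §2])" = Connes–Consani 2023 Prop. 2.1: "`QW_λ` is lower bounded and lower
semi-continuous").  LOWER BOUND: this is the tree's PROVED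
`Literature.NumberTheory.LFunctions.bddBelow_weilQuadratic_sphere_holds` (`Re Q` is bounded below on the unit
`L²`-sphere of test functions on every window) — cited, not restated.  LOWER SEMICONTINUITY (p. 8; "([4, §2])" = Connes–Consani 2023 Prop. 2.1: "`QW_λ` is
lower bounded and lower semi-continuous", `Q(ξ) ≤ liminf Q(ξ_n)` when `ξ_n → ξ`), NAMED FACT in the
operator-free sequential form ON THE FORM CORE of test functions (the tree has no `L²`-extension of `Q`):
for every window `a > 0`, if test functions `g_n`, `u` supported in `[−a, a]` satisfy `g_n → u` in `L²`,
then for every `b < Re Q(u)` eventually `b < Re Q(g_n)`.  (Junk-free: no `liminf` of a possibly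
unbounded real sequence is taken.)  RH-FREE (a topological property of the form; no sign statement).
[cite: ConnesConsaniMoscovici2025, §3.1 Prop. 3.3, p. 8] -/
def ConnesConsaniMoscovici2025_prop_3_3 : Prop :=
  ∀ a : ℝ, 0 < a → ∀ (g : ℕ → ℝ → ℂ) (u : ℝ → ℂ),
    (∀ n, IsWeilTest (g n) ∧ tsupport (g n) ⊆ Icc (-a) a) →
    IsWeilTest u → tsupport u ⊆ Icc (-a) a →
    Tendsto (fun n => ∫ t, ‖g n t - u t‖ ^ 2) atTop (𝓝 0) →
      ∀ b : ℝ, b < (weilQuadratic u).re → ∀ᶠ n in atTop, b < (weilQuadratic (g n)).re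

/-- **(3.21)** `V_n := κ(U_n)`, `V_n(u) = U_n(log(λu))` on `[λ⁻¹, λ]`; additively `t ↦ U_n(t + L/2)` on
`[−L/2, L/2]`.  (`E := span {V_n}` and `E_N := span {V_k : |k| ≤ N}` (p. 8) are `ℂ[U, U⁻¹]` and `E_N` of
[4] §2.1.2, since `V_n = (−1)^n L^{-1/2} U^n` by `vBasis_apply`; they are typed with [4] Prop. 2.3 / Cor. 2.4
= Prop. 3.4 of the source, not here.) [cite: ConnesConsaniMoscovici2025, §3.1 eq. (3.21), p. 8] -/
def vBasis (L : ℝ) (n : ℤ) : ℝ → ℂ :=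
  kappaShift L (uBasis L n)

/-- `V_n(t) = (−1)^n L^{-1/2} e^{2πint/L}` on `[−L/2, L/2]` and `0` outside: `V_n = (−1)^n L^{-1/2} U^n` with
`U(u) = u^{iπ/log λ}` the generator of [4] Lemma 2.2 (`u^{iπn/log λ} = e^{2πint/L}`, `t = log u`).
[cite: ConnesConsaniMoscovici2025, §3.1 eq. (3.21), p. 8] -/
theorem vBasis_apply {L : ℝ} (hL : 0 < L) (n : ℤ) (t : ℝ) :
    vBasis L n t = (Icc (-(L / 2)) (L / 2)).indicator
      (fun t => (-1 : ℂ) ^ n * (((Real.sqrt L)⁻¹ : ℝ) : ℂ) * cexp (2 * π * I * n * t / L)) t := by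
  have hL' : (L : ℂ) ≠ 0 := by exact_mod_cast hL.ne'
  unfold vBasis kappaShift uBasis
  by_cases ht : t ∈ Icc (-(L / 2)) (L / 2)
  · have ht' : t + L / 2 ∈ Icc (0 : ℝ) L := by
      simp only [mem_Icc] at ht ⊢; constructor <;> linarith [ht.1, ht.2]
    rw [indicator_of_mem ht', indicator_of_mem ht]
    unfold uCore
    rw [show (2 * π * I * n * ((t + L / 2 : ℝ) : ℂ) / L : ℂ) = 2 * π * I * n * t / L + n * (π * I) by
      push_cast; field_simp, Complex.exp_add, Complex.exp_int_mul, Complex.exp_pi_mul_I]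
    ring
  · have ht' : t + L / 2 ∉ Icc (0 : ℝ) L := by
      simp only [mem_Icc, not_and_or, not_le] at ht ⊢
      rcases ht with h | h
      · left; linarith
      · right; linarith
    rw [indicator_of_notMem ht', indicator_of_notMem ht]

end Window

/-! ## §3.2 Discrete spectrum: (3.23)–(3.24), Prop. 3.5, Thm. 3.6, Cor. 3.7 (pp. 8–11) — citations -/

section Spectrum

/-! ### Eq. (3.24): the Stirling asymptotic of `∂_tθ` — PROVED from the tree's digamma Stirling series

Write `w = 1/4 + it/2` (`Re w = 1/4`).  Stirling with `ν = 2`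
(`Literature.Analysis.SpecialFunctions.Complex.norm_digamma_sub_stirlingSeries_le`) gives
`ψ(w) = Log w − 1/(2w) − 1/(12w²) + 1/(120w⁴) + D`, `‖D‖ ≤ 4K/‖w‖⁴`; then `Re Log w = log t − log 2 +
½log(1 + 1/(4t²))`, `Re 1/(2w) = 2/(1+4t²)`, `Re w⁻² = 16(1−4t²)/(1+4t²)²`, and each difference to the
printed main term is `O(t⁻⁴)` with explicit constants (for `t ≥ 1`). -/

/-- The point `w = 1/4 + it/2` of the weight `Re ψ(1/4 + it/2)`. [folklore] -/
private def wPt (t : ℝ) : ℂ := 1 / 4 + t / 2 * I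

/-- `Re w = 1/4`. [folklore] -/
private theorem wPt_re (t : ℝ) : (wPt t).re = 1 / 4 := by simp [wPt]

/-- `Im w = t/2`. [folklore] -/
private theorem wPt_im (t : ℝ) : (wPt t).im = t / 2 := by simp [wPt]

/-- `|w|² = (1 + 4t²)/16`. [folklore] -/
private theorem normSq_wPt (t : ℝ) : normSq (wPt t) = (1 + 4 * t ^ 2) / 16 := by
  rw [Complex.normSq_apply, wPt_re, wPt_im]; ring

/-- `Re (1/(2w)) = 2/(1 + 4t²)`. [folklore] -/
private theorem re_inv_two_mul_wPt (t : ℝ) : (1 / (2 * wPt t)).re = 2 / (1 + 4 * t ^ 2) := by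
  have h2w : (2 * wPt t) = ((1 / 2 : ℝ) : ℂ) + (t : ℂ) * I := by
    simp only [wPt]; push_cast; ring
  rw [h2w, one_div, Complex.inv_re, Complex.normSq_apply]
  simp
  field_simp
  ring

/-- `Re (w⁻²) = 16(1 − 4t²)/(1+4t²)²`. [folklore] -/
private theorem re_inv_wPt_sq (t : ℝ) :
    ((wPt t) ^ 2)⁻¹.re = 16 * (1 - 4 * t ^ 2) / (1 + 4 * t ^ 2) ^ 2 := by
  rw [Complex.inv_re, map_pow, normSq_wPt, pow_two (wPt t), Complex.mul_re, wPt_re, wPt_im]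
  have h : (1 + 4 * t ^ 2) ≠ 0 := by positivity
  field_simp
  ring

/-- `‖w‖⁴ = ((1+4t²)/16)²`. [folklore] -/
private theorem norm_wPt_pow_four (t : ℝ) : ‖wPt t‖ ^ 4 = ((1 + 4 * t ^ 2) / 16) ^ 2 := by
  rw [show (4 : ℕ) = 2 * 2 from rfl, pow_mul, ← Complex.normSq_eq_norm_sq, normSq_wPt]

/-- `Re Log w = ½ log((1+4t²)/16)`. [folklore] -/
private theorem re_log_wPt (t : ℝ) : (Complex.log (wPt t)).re = Real.log ((1 + 4 * t ^ 2) / 16) / 2 := by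
  rw [Complex.log_re, ← Real.log_sqrt (by positivity)]
  congr 1
  rw [← normSq_wPt, Complex.normSq_eq_norm_sq, Real.sqrt_sq (norm_nonneg _)]

/-- The Bernoulli sum for `ν = 2`: `B₂/(2w²) + B₄/(4w⁴) = 1/(12w²) − 1/(120w⁴)`. [folklore] -/
private theorem stirlingSum_two (w : ℂ) :
    ∑ k ∈ Finset.Icc 1 2, (bernoulli (2 * k) : ℂ) / (2 * k) / w ^ (2 * k) =
      ((1 / 12 : ℝ) : ℂ) * (w ^ 2)⁻¹ + ((-(1 / 120) : ℝ) : ℂ) * (w ^ 4)⁻¹ := by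
  have hIcc : Finset.Icc 1 2 = ({1, 2} : Finset ℕ) := by decide
  rw [hIcc, Finset.sum_pair (by norm_num)]
  have h2 : bernoulli 2 = 1 / 6 := by
    rw [bernoulli_eq_bernoulli'_of_ne_one (by norm_num), bernoulli'_two]
  have h4 : bernoulli 4 = -1 / 30 := by
    rw [bernoulli_eq_bernoulli'_of_ne_one (by norm_num), bernoulli'_four]
  simp only [mul_one, show 2 * 2 = 4 from rfl, h2, h4]
  push_cast
  ring

/-- Stirling's remainder at `w = 1/4 + it/2` (order `ν = 2`): `‖D‖ ≤ 4K (16/(1+4t²))²`,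
`K = (π²/3)·5!/(2π)⁵`. [folklore] -/
private theorem stirling_wPt (t : ℝ) :
    ‖Complex.digamma (wPt t) - (Complex.log (wPt t) - 1 / (2 * wPt t) -
        (((1 / 12 : ℝ) : ℂ) * ((wPt t) ^ 2)⁻¹ + ((-(1 / 120) : ℝ) : ℂ) * ((wPt t) ^ 4)⁻¹))‖ ≤
      (π ^ 2 / 3 * ((5 : ℕ).factorial : ℝ) / (2 * π) ^ 5 * 4) * (16 / (1 + 4 * t ^ 2)) ^ 2 := by
  have hw : 0 < (wPt t).re := by rw [wPt_re]; norm_num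
  have h := Literature.Analysis.SpecialFunctions.Complex.norm_digamma_sub_stirlingSeries_le hw
    (ν := 2) two_ne_zero
  rw [stirlingSum_two] at h
  refine h.trans (le_of_eq ?_)
  rw [show 2 * 2 = 4 from rfl, show 2 * 2 + 1 = 5 from rfl, norm_wPt_pow_four, wPt_re]
  have h1 : (1 + 4 * t ^ 2) ≠ 0 := by positivity
  field_simp

/-- `Re Log w = log t − log 2 + ½ log(1 + 1/(4t²))` for `t > 0`. [folklore] -/
private theorem re_log_wPt_eq {t : ℝ} (ht : 0 < t) :
    (Complex.log (wPt t)).re = Real.log t - Real.log 2 + Real.log (1 + 1 / (4 * t ^ 2)) / 2 := by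
  rw [re_log_wPt]
  have ht2 : t ^ 2 ≠ 0 := by positivity
  have e : (1 + 4 * t ^ 2) / 16 = (t / 2) ^ 2 * (1 + 1 / (4 * t ^ 2)) := by
    field_simp; ring
  rw [e, Real.log_mul (by positivity) (by positivity), Real.log_pow, Real.log_div ht.ne' two_ne_zero]
  push_cast
  ring

/-- `|log(1 + y) − y| ≤ (4/3) y²` for `0 ≤ y ≤ 1/4`. [folklore] -/
private theorem abs_log_one_add_sub_le {y : ℝ} (hy0 : 0 ≤ y) (hy : y ≤ 1 / 4) :
    |Real.log (1 + y) - y| ≤ 4 / 3 * y ^ 2 := by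
  have h := Real.abs_log_sub_add_sum_range_le (x := -y) (by rw [abs_neg, abs_of_nonneg hy0]; linarith) 1
  simp only [Finset.sum_range_one, zero_add, pow_one, Nat.cast_zero, div_one, sub_neg_eq_add] at h
  rw [abs_neg, abs_of_nonneg hy0] at h
  rw [show Real.log (1 + y) - y = -y + Real.log (1 + y) by ring]
  refine h.trans ?_
  rw [div_le_iff₀ (by linarith)]
  nlinarith [sq_nonneg y]

/-- Term 1: `|Re Log w − (log t − log 2) − 1/(8t²)| ≤ 1/(24 t⁴)` for `t ≥ 1`. [folklore] -/
private theorem e1_bound {t : ℝ} (ht : 1 ≤ t) :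
    |(Complex.log (wPt t)).re - (Real.log t - Real.log 2) - 1 / (8 * t ^ 2)| ≤ 1 / (24 * t ^ 4) := by
  have ht0 : 0 < t := by linarith
  rw [re_log_wPt_eq ht0]
  set y : ℝ := 1 / (4 * t ^ 2) with hy
  have hy0 : 0 ≤ y := by positivity
  have hy4 : y ≤ 1 / 4 := by
    rw [hy, div_le_div_iff₀ (by positivity) (by norm_num)]
    nlinarith
  have e : Real.log t - Real.log 2 + Real.log (1 + y) / 2 - (Real.log t - Real.log 2) - 1 / (8 * t ^ 2) =
      (Real.log (1 + y) - y) / 2 := by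
    rw [hy]; field_simp; ring
  rw [e, abs_div, abs_two]
  have h := abs_log_one_add_sub_le hy0 hy4
  have hy2 : y ^ 2 = 1 / (16 * t ^ 4) := by rw [hy]; field_simp; ring
  rw [hy2] at h
  have ht4 : 0 < t ^ 4 := by positivity
  rw [div_le_iff₀ two_pos]
  refine h.trans (le_of_eq ?_)
  field_simp
  ring

/-- Term 2 (exact): `−Re(1/(2w)) + 1/(2t²) = 1/(2t²(1+4t²))`. [folklore] -/
private theorem e2_eq {t : ℝ} (ht : t ≠ 0) :
    -(1 / (2 * wPt t)).re + 1 / (2 * t ^ 2) = 1 / (2 * t ^ 2 * (1 + 4 * t ^ 2)) := by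
  rw [re_inv_two_mul_wPt]
  have h1 : (1 + 4 * t ^ 2) ≠ 0 := by positivity
  field_simp
  ring

/-- Term 3 (exact): `−(1/12) Re(w⁻²) − 1/(3t²) = −(12t² + 1)/(3t²(1+4t²)²)`. [folklore] -/
private theorem e3_eq {t : ℝ} (ht : t ≠ 0) :
    -(1 / 12) * ((wPt t) ^ 2)⁻¹.re - 1 / (3 * t ^ 2) =
      -(12 * t ^ 2 + 1) / (3 * t ^ 2 * (1 + 4 * t ^ 2) ^ 2) := by
  rw [re_inv_wPt_sq]
  have h1 : (1 + 4 * t ^ 2) ≠ 0 := by positivity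
  field_simp
  ring

/-- Term 4: `|Re(c · w⁻⁴)| ≤ |c| (16/(1+4t²))²`. [folklore] -/
private theorem abs_re_mul_inv_pow_four_le (c t : ℝ) :
    |(((c : ℝ) : ℂ) * ((wPt t) ^ 4)⁻¹).re| ≤ |c| * (16 / (1 + 4 * t ^ 2)) ^ 2 := by
  refine (Complex.abs_re_le_norm _).trans (le_of_eq ?_)
  rw [norm_mul, Complex.norm_real, Real.norm_eq_abs, norm_inv, norm_pow, norm_wPt_pow_four]
  have h1 : (1 + 4 * t ^ 2) ≠ 0 := by positivity
  field_simp

/-- `(16/(1+4t²))² ≤ 16/t⁴` for `t ≠ 0`. [folklore] -/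
private theorem sixteen_div_sq_le {t : ℝ} (ht : t ≠ 0) : (16 / (1 + 4 * t ^ 2)) ^ 2 ≤ 16 / t ^ 4 := by
  have ht2 : 0 < t ^ 2 := by positivity
  have h1 : 16 / (1 + 4 * t ^ 2) ≤ 4 / t ^ 2 := by
    rw [div_le_div_iff₀ (by positivity) ht2]
    nlinarith
  have h0 : 0 ≤ 16 / (1 + 4 * t ^ 2) := by positivity
  calc (16 / (1 + 4 * t ^ 2)) ^ 2 ≤ (4 / t ^ 2) ^ 2 := pow_le_pow_left₀ h0 h1 2
    _ = 16 / t ^ 4 := by field_simp; ring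

/-- **Eq. (3.24), explicit form**: for `t ≥ 1`,
`|∂_tθ(t) − (½(log|t| − log 2 − log π) − 1/(48t²))| ≤ (1 + 32K)/t⁴`, `K = 4·(π²/3)·5!/(2π)⁵` (the Stirling
remainder constant of the tree at `ν = 2`, `Re w = 1/4`).  RH-FREE.
[cite: ConnesConsaniMoscovici2025, §3.2 eq. (3.24), p. 9] -/
theorem ConnesConsaniMoscovici2025_eq_3_24_explicit {t : ℝ} (ht : 1 ≤ t) :
    |riemannSiegelThetaDeriv t - ((Real.log |t| - Real.log 2 - Real.log π) / 2 - 1 / (48 * t ^ 2))| ≤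
      (1 + 32 * (π ^ 2 / 3 * ((5 : ℕ).factorial : ℝ) / (2 * π) ^ 5 * 4)) / t ^ 4 := by
  have ht0 : 0 < t := by linarith
  have htne : t ≠ 0 := ht0.ne'
  have ht4 : 0 < t ^ 4 := by positivity
  set K : ℝ := π ^ 2 / 3 * ((5 : ℕ).factorial : ℝ) / (2 * π) ^ 5 * 4 with hK
  have hK0 : 0 ≤ K := by rw [hK]; positivity
  -- the Stirling decomposition
  set w : ℂ := wPt t with hwdef
  set D : ℂ := Complex.digamma w - (Complex.log w - 1 / (2 * w) -
        (((1 / 12 : ℝ) : ℂ) * (w ^ 2)⁻¹ + ((-(1 / 120) : ℝ) : ℂ) * (w ^ 4)⁻¹)) with hD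
  have hDb : ‖D‖ ≤ K * (16 / (1 + 4 * t ^ 2)) ^ 2 := stirling_wPt t
  have hψ : (Complex.digamma w).re = (Complex.log w).re - (1 / (2 * w)).re -
      ((1 / 12) * ((w ^ 2)⁻¹).re + (((-(1 / 120) : ℝ) : ℂ) * (w ^ 4)⁻¹).re) + D.re := by
    have e : Complex.digamma w = (Complex.log w - 1 / (2 * w) -
        (((1 / 12 : ℝ) : ℂ) * (w ^ 2)⁻¹ + ((-(1 / 120) : ℝ) : ℂ) * (w ^ 4)⁻¹)) + D := by
      rw [hD]; ring
    rw [e]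
    simp only [Complex.add_re, Complex.sub_re, Complex.re_ofReal_mul]
  -- `θ′(t) = Re ψ(w)/2 − (log π)/2` by definition
  have hθ : riemannSiegelThetaDeriv t = (Complex.digamma w).re / 2 - Real.log π / 2 := rfl
  rw [hθ, hψ, abs_of_pos ht0]
  -- the five error terms
  have h1 := e1_bound ht
  have h2 := e2_eq htne
  have h3 := e3_eq htne
  have h4 := abs_re_mul_inv_pow_four_le (-(1 / 120)) t
  have h5 : |D.re| ≤ K * (16 / (1 + 4 * t ^ 2)) ^ 2 := (Complex.abs_re_le_norm D).trans hDb
  have h16 := sixteen_div_sq_le htne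
  have key : ((Complex.log w).re - (1 / (2 * w)).re -
        ((1 / 12) * ((w ^ 2)⁻¹).re + (((-(1 / 120) : ℝ) : ℂ) * (w ^ 4)⁻¹).re) + D.re) / 2 -
        Real.log π / 2 - ((Real.log t - Real.log 2 - Real.log π) / 2 - 1 / (48 * t ^ 2)) =
      (((Complex.log w).re - (Real.log t - Real.log 2) - 1 / (8 * t ^ 2)) +
        (-(1 / (2 * w)).re + 1 / (2 * t ^ 2)) +
        (-(1 / 12) * ((w ^ 2)⁻¹).re - 1 / (3 * t ^ 2)) +
        (-((((-(1 / 120) : ℝ) : ℂ) * (w ^ 4)⁻¹).re)) + D.re) / 2 := by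
    field_simp
    ring
  rw [key, h2, h3, abs_div, abs_two, div_le_iff₀ two_pos]
  have hb2 : |1 / (2 * t ^ 2 * (1 + 4 * t ^ 2))| ≤ 1 / (8 * t ^ 4) := by
    rw [abs_of_pos (by positivity), div_le_div_iff₀ (by positivity) (by positivity)]
    nlinarith
  have hb3 : |-(12 * t ^ 2 + 1) / (3 * t ^ 2 * (1 + 4 * t ^ 2) ^ 2)| ≤ 13 / (48 * t ^ 4) := by
    rw [abs_div, abs_neg, abs_of_pos (by positivity : (0:ℝ) < 12 * t ^ 2 + 1),
      abs_of_pos (by positivity), div_le_div_iff₀ (by positivity) (by positivity)]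
    nlinarith [sq_nonneg t, ht4, mul_pos ht4 ht4]
  have hb4 : |-((((-(1 / 120) : ℝ) : ℂ) * (w ^ 4)⁻¹).re)| ≤ 1 / 120 * (16 / t ^ 4) := by
    rw [abs_neg]
    refine h4.trans ?_
    rw [show |(-(1 / 120) : ℝ)| = 1 / 120 by rw [abs_neg, abs_of_pos (by norm_num)]]
    exact mul_le_mul_of_nonneg_left h16 (by norm_num)
  have hb5 : |D.re| ≤ K * (16 / t ^ 4) := h5.trans (mul_le_mul_of_nonneg_left h16 hK0)
  have habs : ∀ a b c d e : ℝ, |a + b + c + d + e| ≤ |a| + |b| + |c| + |d| + |e| := by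
    intro a b c d e
    have i1 := abs_add_le (a + b + c + d) e
    have i2 := abs_add_le (a + b + c) d
    have i3 := abs_add_le (a + b) c
    have i4 := abs_add_le a b
    linarith
  calc |((Complex.log w).re - (Real.log t - Real.log 2) - 1 / (8 * t ^ 2)) +
        1 / (2 * t ^ 2 * (1 + 4 * t ^ 2)) +
        (-(12 * t ^ 2 + 1) / (3 * t ^ 2 * (1 + 4 * t ^ 2) ^ 2)) +
        (-((((-(1 / 120) : ℝ) : ℂ) * (w ^ 4)⁻¹).re)) + D.re|
      ≤ |(Complex.log w).re - (Real.log t - Real.log 2) - 1 / (8 * t ^ 2)| +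
        |1 / (2 * t ^ 2 * (1 + 4 * t ^ 2))| +
        |-(12 * t ^ 2 + 1) / (3 * t ^ 2 * (1 + 4 * t ^ 2) ^ 2)| +
        |-((((-(1 / 120) : ℝ) : ℂ) * (w ^ 4)⁻¹).re)| + |D.re| := habs _ _ _ _ _
    _ ≤ 1 / (24 * t ^ 4) + 1 / (8 * t ^ 4) + 13 / (48 * t ^ 4) + 1 / 120 * (16 / t ^ 4) +
          K * (16 / t ^ 4) := by
        gcongr
    _ ≤ (1 + 32 * K) / t ^ 4 * 2 := by
        field_simp
        nlinarith [ht4, hK0]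

/-- **Eq. (3.24)** (p. 9): the asymptotic expansion of the weight,
`∂_tθ(t) = ½(log|t| − log 2 − log π) − 1/(48 t²) + O(t⁻⁴)` (`t → +∞`; the weight is even,
`riemannSiegelThetaDeriv_neg_holds`).  PROVED from Stirling's series for `ψ` with explicit remainder
(`Literature.Analysis.SpecialFunctions.Complex.norm_digamma_sub_stirlingSeries_le`, `ν = 2`) — see
`ConnesConsaniMoscovici2025_eq_3_24_explicit` for the constant.  In print (3.24) is used only to replace the
weight by `max(1, log|t|)` in the proof of Thm. 3.6, which the tree proves directly
(`ConnesConsaniMoscovici2025_thm_3_6_holds`).  RH-FREE. [cite: ConnesConsaniMoscovici2025, §3.2 eq. (3.24), p. 9] -/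
theorem ConnesConsaniMoscovici2025_eq_3_24 :
    (fun t : ℝ => riemannSiegelThetaDeriv t -
        ((Real.log |t| - Real.log 2 - Real.log π) / 2 - 1 / (48 * t ^ 2))) =O[atTop]
      fun t : ℝ => t ^ (-4 : ℤ) := by
  refine Asymptotics.IsBigO.of_bound (1 + 32 * (π ^ 2 / 3 * ((5 : ℕ).factorial : ℝ) / (2 * π) ^ 5 * 4)) ?_
  filter_upwards [eventually_ge_atTop (1 : ℝ)] with t ht
  have ht0 : 0 < t := by linarith
  rw [Real.norm_eq_abs, Real.norm_eq_abs, show (t ^ (-4 : ℤ)) = (t ^ 4)⁻¹ by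
    rw [zpow_neg, zpow_ofNat], abs_of_pos (inv_pos.mpr (pow_pos ht0 4)), ← div_eq_mul_inv]
  exact ConnesConsaniMoscovici2025_eq_3_24_explicit ht

/-- **Cor. 3.7** (p. 11): "Let `λ > 1`. There exists `φ ∈ L²([λ⁻¹, λ], d*u)` such that `A_λ φ = μ_λ φ`
where `μ_λ` is the largest lower bound of the spectrum of `A_λ`" — in the tree's operator-free encoding:
every window `a = log λ > 0` carries a ground state (`IsWeilGroundState a u`: an `L²`-limit of a normalised
minimising sequence of test functions, energy `weilGroundEnergy a = μ_λ`).  PROVED: one line from the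
discharged Thm. 3.6 (`ConnesConsaniMoscovici2025_thm_3_6_holds.exists_isWeilGroundState`).  The
monotonicity (3.27) `λ > λ′ ⇒ μ_λ ≤ μ_{λ′}` is the tree's `weilGroundEnergy_anti` (not re-proved here), and
"we cannot assert that `μ_λ ≥ 0`" — indeed `0 ≤ μ_λ` for all `λ` is RH (`UniformWeilPositivityRH.lean`).
RH-FREE. [cite: ConnesConsaniMoscovici2025, §3.2 Cor. 3.7, p. 11] -/
theorem ConnesConsaniMoscovici2025_cor_3_7 {a : ℝ} (ha : 0 < a) : ∃ u : ℝ → ℂ, IsWeilGroundState a u :=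
  ConnesConsaniMoscovici2025_thm_3_6_holds.exists_isWeilGroundState ha

end Spectrum

/-! ## Discharge of `ConnesConsaniMoscovici2025_prop_3_3` (lower semicontinuity on the test core) — PROVED

The printed source of Prop. 3.3 is [4, §2] = Connes–Consani 2023, Prop. 2.1, whose proof runs: "the first
term `Q_∞(f) = ∫ |f̂(t)|² 2∂_tθ(t)/(2π) dt` defines a lower bounded, lower semi-continuous quadratic form …
each of the remaining terms can be written `⟨f | T g⟩` with `T` bounded".  Mirrored here on the window
`[−a, a] ⊆ [−(log (N+1))/2, (log (N+1))/2]`, `N = ⌈e^{2a}⌉`, with the tree's finite-prime analytic form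
`Re Q(f) = 2 Re(f̂(0) conj f̂(1)) − (log π)‖f‖₂² + (1/2π) ∫ |f̂(1/2+it)|² w_N(t) dt`
(`weilQuadratic_re_eq_weilFinitePrimeQuadratic`): the weight `w_N = Re ψ(1/4+it/2) − ρ_N` is bounded below
(`reDigammaQuarter_zero_le`, `|ρ_N| ≤ 2 Σ_{n≤N} Λ(n)/√n`), so after a shift `w_N + C ≥ 0` the weighted term is
lower semicontinuous by FATOU (`lintegral_liminf_le`) along `ĝ_n(1/2+it) → û(1/2+it)` (pointwise, from
`‖(g_n − u)^(s)‖ ≤ e^{a/2} ‖g_n − u‖₁ ≤ e^{a/2} √(2a) ‖g_n − u‖₂` for `|Re s − 1/2| ≤ 1/2`), while the polar term,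
`‖·‖₂²` and the shift are `L²`-continuous ("bounded" terms). -/

section Prop33Proof

variable {f g h : ℝ → ℂ}

/-- Differences of test functions are test functions. [folklore] -/
private theorem isWeilTest_sub' (hg : IsWeilTest g) (hh : IsWeilTest h) : IsWeilTest (g - h) :=
  ⟨hg.1.sub hh.1, hg.2.sub hh.2⟩

/-- `(g − h)^ = ĝ − ĥ` for test functions. [folklore] -/
private theorem weilMellin_sub' (hg : IsWeilTest g) (hh : IsWeilTest h) (s : ℂ) :
    weilMellin (g - h) s = weilMellin g s - weilMellin h s := by
  have e : g - h = g + fun t ↦ (-1 : ℂ) * h t := by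
    funext t; simp [sub_eq_add_neg]
  rw [e, weilMellin_add hg.1.continuous hg.2 (hh.const_mul (-1)).1.continuous (hh.const_mul (-1)).2,
    weilMellin_const_mul]
  ring

/-- Supports of differences stay in the window. [folklore] -/
private theorem tsupport_sub_subset_Icc {a : ℝ} (hg : tsupport g ⊆ Icc (-a) a)
    (hh : tsupport h ⊆ Icc (-a) a) : tsupport (g - h) ⊆ Icc (-a) a := by
  have h1 : Function.support (g - h) ⊆ tsupport g ∪ tsupport h := by
    intro t ht
    rw [Function.mem_support, Pi.sub_apply] at ht
    by_contra hnot
    rw [Set.mem_union, not_or] at hnot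
    have hg0 : g t = 0 := image_eq_zero_of_notMem_tsupport hnot.1
    have hh0 : h t = 0 := image_eq_zero_of_notMem_tsupport hnot.2
    exact ht (by rw [hg0, hh0, sub_zero])
  exact (closure_minimal h1 ((isClosed_tsupport g).union (isClosed_tsupport h))).trans
    (Set.union_subset hg hh)

/-- `‖Ŵ(s)‖ ≤ e^{b/2} ‖W‖₁` for `|Re s − 1/2| ≤ 1/2` and `tsupport W ⊆ [−b, b]` (exponential type off the
critical line; [4] Prop. 2.1: the polar evaluations are bounded functionals on the window). [folklore] -/
private theorem norm_weilMellin_le_exp_half_mul_weilNorm1 {W : ℝ → ℂ} (hW : IsWeilTest W) {b : ℝ}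
    (hsupp : tsupport W ⊆ Icc (-b) b) {s : ℂ} (hs : |s.re - 1 / 2| ≤ 1 / 2) :
    ‖weilMellin W s‖ ≤ Real.exp (b / 2) * weilNorm1 W := by
  refine (norm_weilMellin_le_weilL1W hW.1.continuous hW.2 hs).trans ?_
  unfold weilL1W weilNorm1
  rw [← integral_const_mul]
  refine integral_mono_of_nonneg (Eventually.of_forall fun t => by positivity)
    ((hW.1.continuous.norm.const_mul _).integrable_of_hasCompactSupport (hW.2.norm.mul_left))
    (Eventually.of_forall fun t => ?_)
  show ‖W t‖ * Real.exp (1 / 2 * |t|) ≤ Real.exp (b / 2) * ‖W t‖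
  by_cases ht : W t = 0
  · simp [ht]
  · have hmem : t ∈ Icc (-b) b := hsupp (subset_tsupport _ (Function.mem_support.2 ht))
    rw [mem_Icc] at hmem
    have habs : |t| ≤ b := abs_le.2 ⟨hmem.1, hmem.2⟩
    rw [mul_comm]
    refine mul_le_mul_of_nonneg_right (Real.exp_le_exp.2 ?_) (norm_nonneg _)
    nlinarith [abs_nonneg t]

/-- `‖W‖₁ ≤ √(2b ∫‖W‖²)` on the window (Cauchy–Schwarz, `weilNorm1_sq_le`). [folklore] -/
private theorem weilNorm1_le_sqrt {W : ℝ → ℂ} (hW : IsWeilTest W) {b : ℝ} (hb : 0 < b)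
    (hsupp : tsupport W ⊆ Icc (-b) b) :
    weilNorm1 W ≤ Real.sqrt (2 * b * ∫ t, ‖W t‖ ^ 2) := by
  have h := weilNorm1_sq_le hW hb hsupp
  unfold weilNorm2Sq at h
  exact Real.le_sqrt_of_sq_le h

/-- `L²`-convergence on the window gives convergence of the transforms at every `s` with
`|Re s − 1/2| ≤ 1/2` (critical line and the polar points `0, 1`). [folklore] -/
private theorem tendsto_weilMellin_of_tendsto_L2 {a : ℝ} (ha : 0 < a) {G : ℕ → ℝ → ℂ} {u : ℝ → ℂ}
    (hG : ∀ n, IsWeilTest (G n) ∧ tsupport (G n) ⊆ Icc (-a) a) (hu : IsWeilTest u)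
    (hus : tsupport u ⊆ Icc (-a) a)
    (hlim : Tendsto (fun n => ∫ t, ‖G n t - u t‖ ^ 2) atTop (𝓝 0)) {s : ℂ}
    (hs : |s.re - 1 / 2| ≤ 1 / 2) :
    Tendsto (fun n => weilMellin (G n) s) atTop (𝓝 (weilMellin u s)) := by
  rw [tendsto_iff_norm_sub_tendsto_zero]
  have hbound : ∀ n, ‖weilMellin (G n) s - weilMellin u s‖ ≤
      Real.exp (a / 2) * Real.sqrt (2 * a * ∫ t, ‖G n t - u t‖ ^ 2) := by
    intro n
    have hd : IsWeilTest (G n - u) := isWeilTest_sub' (hG n).1 hu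
    have hds : tsupport (G n - u) ⊆ Icc (-a) a := tsupport_sub_subset_Icc (hG n).2 hus
    rw [← weilMellin_sub' (hG n).1 hu]
    refine (norm_weilMellin_le_exp_half_mul_weilNorm1 hd hds hs).trans ?_
    exact mul_le_mul_of_nonneg_left (weilNorm1_le_sqrt hd ha hds) (Real.exp_pos _).le
  have hlim' : Tendsto (fun n => Real.exp (a / 2) * Real.sqrt (2 * a * ∫ t, ‖G n t - u t‖ ^ 2))
      atTop (𝓝 0) := by
    have h1 : Tendsto (fun n => 2 * a * ∫ t, ‖G n t - u t‖ ^ 2) atTop (𝓝 0) := by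
      simpa using hlim.const_mul (2 * a)
    have h2 := (Real.continuous_sqrt.tendsto 0).comp h1
    rw [Real.sqrt_zero] at h2
    simpa using h2.const_mul (Real.exp (a / 2))
  exact squeeze_zero (fun n => norm_nonneg _) hbound hlim'

/-- `L²`-convergence gives `‖g_n‖₂² → ‖u‖₂²`. [folklore] -/
private theorem tendsto_weilNorm2Sq_of_tendsto_L2 {G : ℕ → ℝ → ℂ} {u : ℝ → ℂ}
    (hG : ∀ n, IsWeilTest (G n)) (hu : IsWeilTest u)
    (hlim : Tendsto (fun n => ∫ t, ‖G n t - u t‖ ^ 2) atTop (𝓝 0)) :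
    Tendsto (fun n => weilNorm2Sq (G n)) atTop (𝓝 (weilNorm2Sq u)) := by
  have hGm : ∀ n, MemLp (G n) 2 := fun n => (hG n).1.continuous.memLp_of_hasCompactSupport (hG n).2
  have hum : MemLp u 2 := hu.1.continuous.memLp_of_hasCompactSupport hu.2
  have hsqrt : Tendsto (fun n => Real.sqrt (∫ t, ‖G n t‖ ^ 2)) atTop
      (𝓝 (Real.sqrt (∫ t, ‖u t‖ ^ 2))) := by
    rw [tendsto_iff_norm_sub_tendsto_zero]
    have hb : ∀ n, ‖Real.sqrt (∫ t, ‖G n t‖ ^ 2) - Real.sqrt (∫ t, ‖u t‖ ^ 2)‖ ≤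
        Real.sqrt (∫ t, ‖G n t - u t‖ ^ 2) := by
      intro n
      rw [Real.norm_eq_abs, abs_sub_le_iff]
      constructor
      · have h := sqrt_integral_norm_sq_sub_le ((hGm n).sub hum) hum.neg
        have e2 : (∫ t, ‖(-u) t‖ ^ 2) = ∫ t, ‖u t‖ ^ 2 := by simp
        simp only [e2] at h
        have e3 : (∫ t, ‖(G n - u) t - (-u) t‖ ^ 2) = ∫ t, ‖G n t‖ ^ 2 := by
          congr 1; funext t; simp
        rw [e3] at h
        have e4 : (∫ t, ‖(G n - u) t‖ ^ 2) = ∫ t, ‖G n t - u t‖ ^ 2 := by simp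
        rw [e4] at h
        linarith
      · have h := sqrt_integral_norm_sq_sub_le (hum.sub (hGm n)) (hGm n).neg
        have e2 : (∫ t, ‖(-G n) t‖ ^ 2) = ∫ t, ‖G n t‖ ^ 2 := by simp
        simp only [e2] at h
        have e3 : (∫ t, ‖(u - G n) t - (-G n) t‖ ^ 2) = ∫ t, ‖u t‖ ^ 2 := by
          congr 1; funext t; simp
        rw [e3] at h
        have e4 : (∫ t, ‖(u - G n) t‖ ^ 2) = ∫ t, ‖G n t - u t‖ ^ 2 := by
          congr 1; funext t; rw [Pi.sub_apply, norm_sub_rev]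
        rw [e4] at h
        linarith
    have h2 := (Real.continuous_sqrt.tendsto 0).comp hlim
    rw [Real.sqrt_zero] at h2
    exact squeeze_zero (fun n => norm_nonneg _) hb h2
  have hsq := hsqrt.pow 2
  have e1 : (fun n => Real.sqrt (∫ t, ‖G n t‖ ^ 2) ^ 2) = fun n => weilNorm2Sq (G n) := by
    funext n
    rw [Real.sq_sqrt (integral_nonneg fun t => sq_nonneg _)]
    rfl
  have e2 : Real.sqrt (∫ t, ‖u t‖ ^ 2) ^ 2 = weilNorm2Sq u := by
    rw [Real.sq_sqrt (integral_nonneg fun t => sq_nonneg _)]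
    rfl
  rw [e1, e2] at hsq
  exact hsq

/-- The prime ripple is bounded: `ρ_N(t) ≤ 2 Σ_{n ≤ N} Λ(n)/√n` ([4] Prop. 2.1: "`V(n)` is bounded").
[folklore] -/
private theorem weilPrimeRipple_le_sum (N : ℕ) (t : ℝ) :
    weilPrimeRipple N t ≤
      ∑ n ∈ Finset.range (N + 1), (ArithmeticFunction.vonMangoldt n : ℝ) / Real.sqrt n * 2 := by
  unfold weilPrimeRipple
  refine Finset.sum_le_sum fun n _ => ?_
  refine mul_le_mul_of_nonneg_left ?_
    (div_nonneg ArithmeticFunction.vonMangoldt_nonneg (Real.sqrt_nonneg _))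
  linarith [Real.cos_le_one (t * Real.log n)]

/-- The finite-prime weight is bounded below: some shift `C` makes `w_N + C ≥ 0`
(`Re ψ(1/4+it/2) ≥ Re ψ(1/4)` and the ripple bound). [folklore] -/
private theorem exists_weilFinitePrimeWeight_add_nonneg (N : ℕ) :
    ∃ C : ℝ, ∀ t : ℝ, 0 ≤ weilFinitePrimeWeight N t + C := by
  refine ⟨∑ n ∈ Finset.range (N + 1), (ArithmeticFunction.vonMangoldt n : ℝ) / Real.sqrt n * 2 -
    Literature.Analysis.SpecialFunctions.reDigammaQuarter 0, fun t => ?_⟩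
  unfold weilFinitePrimeWeight
  linarith [weilPrimeRipple_le_sum N t, Literature.Analysis.SpecialFunctions.reDigammaQuarter_zero_le t]

/-- Integrability of the shifted weighted integrand. [folklore] -/
private theorem integrable_normSq_mul_shiftedWeight (hf : IsWeilTest f) (N : ℕ) (C : ℝ) :
    Integrable fun t : ℝ =>
      ‖weilMellin f (1 / 2 + t * I)‖ ^ 2 * (weilFinitePrimeWeight N t + C) := by
  have h1 := integrable_norm_sq_weilMellin_mul_weilFinitePrimeWeight hf N
  have h2 := (integrable_norm_sq_weilMellin_half_line hf).mul_const C
  have e : (fun t : ℝ => ‖weilMellin f (1 / 2 + t * I)‖ ^ 2 * (weilFinitePrimeWeight N t + C)) =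
      fun t : ℝ => ‖weilMellin f (1 / 2 + t * I)‖ ^ 2 * weilFinitePrimeWeight N t +
        ‖weilMellin f (1 / 2 + t * I)‖ ^ 2 * C := by
    funext t; ring
  rw [e]
  exact h1.add h2

/-- Measurability of the shifted weighted integrand. [folklore] -/
private theorem measurable_normSq_mul_shiftedWeight (hf : IsWeilTest f) (N : ℕ) (C : ℝ) :
    Measurable fun t : ℝ =>
      ‖weilMellin f (1 / 2 + t * I)‖ ^ 2 * (weilFinitePrimeWeight N t + C) := by
  have hc : Continuous fun t : ℝ => weilMellin f (1 / 2 + t * I) :=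
    (continuous_weilMellin hf.1.continuous hf.2).comp (by fun_prop)
  exact (hc.norm.pow 2).measurable.mul ((measurable_weilFinitePrimeWeight N).add measurable_const)

/-- The shifted decomposition `Re Q(f) = 2Re(f̂(0) conj f̂(1)) − (log π + C)‖f‖₂² + (1/2π) ∫ |f̂|² (w_N + C)`
on `C((log (N+1))/2)` (Plancherel moves the shift into `‖f‖₂²`). [folklore] -/
private theorem re_weilQuadratic_eq_shifted (hf : IsWeilTest f) (N : ℕ) (C : ℝ)
    (hsupp : tsupport f ⊆ Icc (-(Real.log ((N : ℝ) + 1) / 2)) (Real.log ((N : ℝ) + 1) / 2)) :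
    (weilQuadratic f).re = 2 * (weilMellin f 0 * conj (weilMellin f 1)).re -
      (Real.log π + C) * weilNorm2Sq f +
      1 / (2 * π) * ∫ t : ℝ, ‖weilMellin f (1 / 2 + t * I)‖ ^ 2 * (weilFinitePrimeWeight N t + C) := by
  rw [weilQuadratic_re_eq_weilFinitePrimeQuadratic hf N hsupp]
  unfold weilFinitePrimeQuadratic
  have h1 := integrable_norm_sq_weilMellin_mul_weilFinitePrimeWeight hf N
  have h2 := (integrable_norm_sq_weilMellin_half_line hf).const_mul C
  have e : (∫ t : ℝ, ‖weilMellin f (1 / 2 + t * I)‖ ^ 2 * (weilFinitePrimeWeight N t + C)) =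
      (∫ t : ℝ, ‖weilMellin f (1 / 2 + t * I)‖ ^ 2 * weilFinitePrimeWeight N t) +
        C * (2 * π * weilNorm2Sq f) := by
    rw [← integral_norm_sq_weilMellin_half_line hf, ← integral_const_mul, ← integral_add h1 h2]
    congr 1
    funext t
    ring
  rw [e]
  set A : ℝ := ∫ t : ℝ, ‖weilMellin f (1 / 2 + t * I)‖ ^ 2 * weilFinitePrimeWeight N t
  set P : ℝ := (weilMellin f 0 * conj (weilMellin f 1)).re
  have hpi : (π : ℝ) ≠ 0 := Real.pi_ne_zero
  field_simp
  ring

/-- **Fatou step**: the shifted weighted term is lower semicontinuous along `g_n → u` in `L²` on the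
window — for every `c` below its value at `u` it eventually exceeds `c` at `g_n` ([4] Prop. 2.1: "`Q_∞`
defines a lower bounded, lower semi-continuous quadratic form"). [folklore] -/
private theorem eventually_lt_shiftedIntegral {a : ℝ} (ha : 0 < a) (N : ℕ) {C : ℝ}
    (hC : ∀ t : ℝ, 0 ≤ weilFinitePrimeWeight N t + C) {G : ℕ → ℝ → ℂ} {u : ℝ → ℂ}
    (hG : ∀ n, IsWeilTest (G n) ∧ tsupport (G n) ⊆ Icc (-a) a) (hu : IsWeilTest u)
    (hus : tsupport u ⊆ Icc (-a) a)
    (hlim : Tendsto (fun n => ∫ t, ‖G n t - u t‖ ^ 2) atTop (𝓝 0)) {c : ℝ}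
    (hc : c < ∫ t : ℝ, ‖weilMellin u (1 / 2 + t * I)‖ ^ 2 * (weilFinitePrimeWeight N t + C)) :
    ∀ᶠ n in atTop, c < ∫ t : ℝ, ‖weilMellin (G n) (1 / 2 + t * I)‖ ^ 2 * (weilFinitePrimeWeight N t + C) := by
  -- the integrands as `ENNReal`-valued functions and the integrals `J`
  set J : (ℝ → ℂ) → ℝ := fun f =>
    ∫ t : ℝ, ‖weilMellin f (1 / 2 + t * I)‖ ^ 2 * (weilFinitePrimeWeight N t + C) with hJdef
  set Φ : (ℝ → ℂ) → ℝ → ENNReal := fun f t =>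
    ENNReal.ofReal (‖weilMellin f (1 / 2 + t * I)‖ ^ 2 * (weilFinitePrimeWeight N t + C)) with hΦ
  have hJ : ∀ {f : ℝ → ℂ}, IsWeilTest f → ENNReal.ofReal (J f) = ∫⁻ t, Φ f t := by
    intro f hf
    simp only [hJdef]
    rw [ofReal_integral_eq_lintegral_ofReal (integrable_normSq_mul_shiftedWeight hf N C)
      (Eventually.of_forall fun t => mul_nonneg (by positivity) (hC t))]
  -- pointwise convergence of the integrands
  have hpt : ∀ t : ℝ, Tendsto (fun n => Φ (G n) t) atTop (𝓝 (Φ u t)) := by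
    intro t
    have h1 : Tendsto (fun n => weilMellin (G n) (1 / 2 + t * I)) atTop
        (𝓝 (weilMellin u (1 / 2 + t * I))) :=
      tendsto_weilMellin_of_tendsto_L2 ha hG hu hus hlim (by simp)
    exact ENNReal.tendsto_ofReal ((h1.norm.pow 2).mul_const _)
  -- Fatou
  have hF := lintegral_liminf_le (μ := (volume : Measure ℝ)) (u := (atTop : Filter ℕ))
    (f := fun n => Φ (G n)) (fun n => (measurable_normSq_mul_shiftedWeight (hG n).1 N C).ennreal_ofReal)
  have hlim_eq : (fun t => liminf (fun n => Φ (G n) t) atTop) = Φ u := by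
    funext t; exact (hpt t).liminf_eq
  rw [hlim_eq, ← hJ hu] at hF
  change c < J u at hc
  change ∀ᶠ n in atTop, c < J (G n)
  by_cases hc0 : c < 0
  · refine Eventually.of_forall fun n => hc0.trans_le ?_
    exact integral_nonneg fun t => mul_nonneg (by positivity) (hC t)
  · rw [not_lt] at hc0
    have hJu : 0 < J u := hc0.trans_lt hc
    have h1 : ENNReal.ofReal c < liminf (fun n => ∫⁻ t, Φ (G n) t) atTop :=
      lt_of_lt_of_le ((ENNReal.ofReal_lt_ofReal_iff hJu).2 hc) hF
    have h2 := Filter.eventually_lt_of_lt_liminf h1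
    filter_upwards [h2] with n hn
    rw [← hJ (hG n).1] at hn
    exact ((ENNReal.ofReal_lt_ofReal_iff').1 hn).1

/-- **Discharge of `ConnesConsaniMoscovici2025_prop_3_3`** (Prop. 3.3, p. 8 = [4] Prop. 2.1, lsc clause):
Weil's quadratic form is lower semicontinuous along `L²`-convergent sequences of test functions on a fixed
window — PROVED by the route of [4] Prop. 2.1 (lsc weighted Fourier-side term + bounded remainder), in the
tree's finite-prime analytic form.  RH-FREE.
[cite: ConnesConsaniMoscovici2025, §3.1 Prop. 3.3, p. 8; ConnesConsani2023 §2.1 Prop. 2.1] -/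
theorem ConnesConsaniMoscovici2025_prop_3_3_holds : ConnesConsaniMoscovici2025_prop_3_3 := by
  intro a ha G u hG hu hus hlim b hb
  -- the number of prime powers seen on the window: `2a < log (N + 1)`
  set N : ℕ := ⌈Real.exp (2 * a)⌉₊ with hN
  have hwin : Icc (-a) a ⊆ Icc (-(Real.log ((N : ℝ) + 1) / 2)) (Real.log ((N : ℝ) + 1) / 2) := by
    have h1 : Real.exp (2 * a) < (N : ℝ) + 1 :=
      (Nat.le_ceil _).trans_lt (by rw [hN]; exact_mod_cast Nat.lt_succ_self _)
    have h2 : 2 * a < Real.log ((N : ℝ) + 1) := by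
      rw [Real.lt_log_iff_exp_lt (by positivity)]; exact h1
    exact Icc_subset_Icc (by linarith) (by linarith)
  obtain ⟨C, hC⟩ := exists_weilFinitePrimeWeight_add_nonneg N
  -- the decomposition `Re Q = B + J/(2π)` on the window
  set J : (ℝ → ℂ) → ℝ := fun f =>
    ∫ t : ℝ, ‖weilMellin f (1 / 2 + t * I)‖ ^ 2 * (weilFinitePrimeWeight N t + C) with hJdef
  set B : (ℝ → ℂ) → ℝ := fun f =>
    2 * (weilMellin f 0 * conj (weilMellin f 1)).re - (Real.log π + C) * weilNorm2Sq f with hB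
  have hdec : ∀ {f : ℝ → ℂ}, IsWeilTest f → tsupport f ⊆ Icc (-a) a →
      (weilQuadratic f).re = B f + 1 / (2 * π) * J f :=
    fun hf hfs => re_weilQuadratic_eq_shifted hf N C (hfs.trans hwin)
  -- the bounded part converges
  have hBlim : Tendsto (fun n => B (G n)) atTop (𝓝 (B u)) := by
    have h0 := tendsto_weilMellin_of_tendsto_L2 ha hG hu hus hlim (s := 0) (by norm_num)
    have h1 := tendsto_weilMellin_of_tendsto_L2 ha hG hu hus hlim (s := 1) (by norm_num)
    have h2 := tendsto_weilNorm2Sq_of_tendsto_L2 (fun n => (hG n).1) hu hlim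
    have hprod : Tendsto (fun n => weilMellin (G n) 0 * conj (weilMellin (G n) 1)) atTop
        (𝓝 (weilMellin u 0 * conj (weilMellin u 1))) :=
      h0.mul ((Complex.continuous_conj.tendsto _).comp h1)
    have hre := (Complex.continuous_re.tendsto _).comp hprod
    simp only [hB]
    exact ((hre.const_mul 2).sub (h2.const_mul _))
  -- split the margin `Re Q(u) − b = 2ε`
  have hQu : (weilQuadratic u).re = B u + 1 / (2 * π) * J u := hdec hu hus
  set ε : ℝ := ((weilQuadratic u).re - b) / 2 with hε
  have hε0 : 0 < ε := by rw [hε]; linarith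
  have hev1 : ∀ᶠ n in atTop, B u - ε < B (G n) := hBlim.eventually (Ioi_mem_nhds (by linarith))
  have hev2 : ∀ᶠ n in atTop, J u - 2 * π * ε < J (G n) :=
    eventually_lt_shiftedIntegral ha N hC hG hu hus hlim (by nlinarith [Real.pi_pos])
  filter_upwards [hev1, hev2] with n h1 h2
  rw [hdec (hG n).1 (hG n).2]
  have h3 : 1 / (2 * π) * (J u - 2 * π * ε) < 1 / (2 * π) * J (G n) :=
    mul_lt_mul_of_pos_left h2 (by positivity)
  have e : 1 / (2 * π) * (J u - 2 * π * ε) = 1 / (2 * π) * J u - ε := by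
    field_simp
  rw [e] at h3
  have hb' : b = (weilQuadratic u).re - 2 * ε := by rw [hε]; ring
  rw [hb', hQu]
  linarith

end Prop33Proof

/-! ## Dictionary with Connes–van Suijlekom 2025 §4 (already in the tree): `U_n`, `U_m* ∗ U_n`, `q(U_m, U_n)`

CCM 2025 §2.2 re-uses the basis and the autocorrelation kernels of A. Connes, W. D. van Suijlekom,
*Quadratic forms, real zeros and echoes of the spectral action*, CMP 406 (2025) §4, (4.2)–(4.5), typed in
`Literature/Analysis/Fourier/TrigAutocorrelationDividedDifference.lean` (`ConnesVanSuijlekom.trigBasis`,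
`autocorr`, `symAutocorr`, with (4.4) = `symAutocorr_of_ne` = CCM (2.8)/(2.9) and (4.5) = `symAutocorr_self` =
CCM (2.10), and `autocorr_neg` = the corrected (2.5)).  The three identifications below are PROVED, so the
two typings are one object (no parallel vocabulary): `uBasis = trigBasis`, `U_m* ∗ U_n = autocorr`,
`q(U_m,U_n) = symAutocorr`. -/

section BridgeCvS

/-- CCM 2025's `U_n` (2.6) IS Connes–van Suijlekom 2025's `U_n` (C–vS (4.2)), already in the tree as
`Literature.Analysis.Fourier.ConnesVanSuijlekom.trigBasis`: the two definitions agree (same truncated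
exponential; only the spelling of the exponent differs). [cite: ConnesConsaniMoscovici2025, §2.2 eq. (2.6), p. 3] -/
theorem uBasis_eq_trigBasis (L : ℝ) (n : ℤ) :
    uBasis L n = Literature.Analysis.Fourier.ConnesVanSuijlekom.trigBasis L n := by
  funext x
  unfold uBasis Literature.Analysis.Fourier.ConnesVanSuijlekom.trigBasis uCore
  by_cases hx : x ∈ Icc (0 : ℝ) L
  · rw [indicator_of_mem hx, indicator_of_mem hx]
    congr 2
    push_cast
    ring
  · rw [indicator_of_notMem hx, indicator_of_notMem hx]

/-- `(U_m* ∗ U_n)(y)` in the tree's convolution language IS C–vS's autocorrelation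
`Literature.Analysis.Fourier.ConnesVanSuijlekom.autocorr L m n y = ∫ conj(U_m(x − y)) U_n(x) dx`
(substitution `x = y − u`). [cite: ConnesConsaniMoscovici2025, §2.2 proof of (2.7), p. 4] -/
theorem weilConv_weilReflect_uBasis_eq_autocorr (L : ℝ) (m n : ℤ) (y : ℝ) :
    weilConv (weilReflect (uBasis L m)) (uBasis L n) y =
      Literature.Analysis.Fourier.ConnesVanSuijlekom.autocorr L m n y := by
  unfold Literature.Analysis.Fourier.ConnesVanSuijlekom.autocorr
  rw [weilConv_apply, ← uBasis_eq_trigBasis L m, ← uBasis_eq_trigBasis L n,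
    ← integral_sub_left_eq_self (fun x => conj (uBasis L m (x - y)) * uBasis L n x) volume y]
  congr 1
  funext u
  simp only [weilReflect]
  rw [show y - u - y = -u by ring]

/-- CCM 2025's `q(U_m, U_n)` IS C–vS's symmetrised kernel
`Literature.Analysis.Fourier.ConnesVanSuijlekom.symAutocorr L m n` (C–vS (4.3)); hence CCM (2.8)–(2.10) /
Lemma 2.3 (`ConnesConsaniMoscovici2025_lemma_2_3`) and C–vS (4.4)–(4.5) (`symAutocorr_of_ne`,
`symAutocorr_self`) are the same closed forms. [cite: ConnesConsaniMoscovici2025, §2.2 Lemma 2.3, p. 4] -/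
theorem qForm_uBasis_eq_symAutocorr (L : ℝ) (m n : ℤ) (y : ℝ) :
    qForm (uBasis L m) (uBasis L n) y = Literature.Analysis.Fourier.ConnesVanSuijlekom.symAutocorr L m n y := by
  unfold qForm Literature.Analysis.Fourier.ConnesVanSuijlekom.symAutocorr
  rw [weilConv_weilReflect_uBasis_eq_autocorr, weilConv_weilReflect_uBasis_eq_autocorr]

end BridgeCvS

end Literature.NumberTheory.ConnesConsani2025

end
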